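import Mathlib
import Literature.NumberTheory.LFunctions.Zhang2022.Section10CRanges1422
import Literature.NumberTheory.LFunctions.Zhang2022.Section10Lemma102SSteps
import Literature.NumberTheory.LFunctions.Zhang2022.Section10Lemma102LogMean
import Literature.NumberTheory.LFunctions.Zhang2022.AppendixALemma83RelHolds
import Literature.NumberTheory.LFunctions.Zhang2022.Section8XiZeroTailMeanLogFree
import Literature.NumberTheory.LFunctions.Zhang2022.Section9SharpApplications
import Literature.NumberTheory.LFunctions.Zhang2022.Section8FrontEnd82
import Literature.NumberTheory.LFunctions.Zhang2022.Section10Range1321MidRel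
import Literature.NumberTheory.LFunctions.Zhang2022.Section10Sj1321Top
import Literature.NumberTheory.LFunctions.Zhang2022.Section12Eq1212Profiles
import HarnessLib

/-!
# Zhang (2022) §10, `Θ₁(𝐚₁₂,𝐚₁₄)`: the low range `dr < P^{0.496}` — node `Z22:§10.u055 (i)`
# (`Typed.Sec10C.Low1214Eval`) PROVED OUTRIGHT

Topic `Literature/NumberTheory/LFunctions/Zhang2022` (Landau–Siegel audit tree; verdict-neutral).
Y. Zhang, *Discrete mean estimates and the Landau–Siegel zero*, arXiv:2211.02515v1 (2022)
[Zhang2022LandauSiegel], §10 p. 60 (tex L3081, first line):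

> "By a result similar to Lemma 10.2 and the results in Section 8, the sum over `dr < P^{0.496}` is
> equal to `(L′(1,χ)²/500)β_{j+1}β_{j+2} Σ_{n<P^{0.496}} |χ(n)|λ₀ⱼ(n)φ(n)⁻¹
> (ῑ₃𝔣_{j6}(P^{0.498}/n)/0.498 + ῑ₄𝔣_{j7}(P^{0.5}/n)/0.5) + o(α)`"

— **an unrefereed manuscript under adjudication; this file proves ONE of its displayed steps from
tree theorems and asserts nothing about its Theorems 1–2 or about Landau–Siegel zeros.** ZHANG-L
discharge lane (WP10, seat zl-w10-p4; helper under the leaf `Typed.Sec10C.Gather1214`, hypothesis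
`hG1214` of `Skeleton.theorem1_of_leaves_v19…v21`, held by zl-w10-p1; split of the three range
evaluations: low = this file, middle = zl-w10-p1, top = zl-w10-p2).

`low1214Eval_holds : 0 ≤ c′ → Low1214Eval c′` — NO manuscript claim as hypothesis. The deduction,
made explicit (pattern of L3-t4's `Section10CRanges1422` for `S_j(𝐚₁₄,𝐚₂₂)`, with the roles of the
two inner sums exchanged):

* the `m`-sum `Σ_m χ(m)(ῑ₃ϰ₃(nm) + ῑ₄ϰ₂(nm))m^{−(1−β_j)}` (`Typed.Sec10C.mSum12`, a function of
  `n = dr`) is `L′(1,χ)(ῑ₃𝔣_{j6}(P₃/n)/log P₃ + ῑ₄𝔣_{j7}(P₂/n)/log P₂) + O(𝓛⁻¹⁵)` on the WHOLE low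
  range (Lemma 8.2 at `P₃/n`, `P₂/n`: tree `Section9Discharge.step9u002_sharp`,
  `Section8FrontEnd82.step8u041_holds`, both from `Skeleton.lemma82_holds`), and the printed profile
  (`P^{0.5}`, `1/0.5` in place of `P₂ = P^{1/2}T^{−10}`, `1/log P₂`) differs from it by
  `≪ 𝓛^{1.1}𝓛⁻¹⁸ · |L′|` (`norm_F7swap_le`, on zl-w12-p10's `Typed.Sec12C.norm_frakfW7_P2_sub_le`);
* the `n`-sum `Typed.Sec10C.nSum14 = frakv2S` (the SHIFTED `𝔳₂ⱼ`, `y* = drP^{0.004}/(Dt₀)`) is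
  `(L′(1,χ)Π(d,r)/500)β_{j+1}β_{j+2}log P + O(𝓛⁻¹⁵(dr/φ(dr))²)` for `y* ≤ P^{0.5}/T` (zl-w10-p1's
  `Lemma102.eq108SRel_of_logMean` fed with LEMMA A = zl-w10-p6's `Lemma102.logMeanRel_of_lemma83Rel`
  at the tree theorem `Skeleton.lemma83Rel_holds`), and on the remaining `y*`-window
  `P^{0.5}/T < y* < P^{0.5}` (i.e. `P^{0.496}Dt₀/T < dr < P^{0.496}`) it is crudely
  `≪ 𝓛^{4.4}𝓛⁻⁹(dr/φ(dr))²` (`norm_frakv2S_crude_le`: the two log-means at `P^{0.504}/y*`,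
  `P^{0.502}/y* ≥ T` by LEMMA A, the one at `P^{0.5}/y* < T` by zl-w10-p2's log-free `ξ₀`-tail mean
  `XiZeroMajorant.xiZeroTailMean_logFree`);
* the `(d,r) ↦ n = dr` collapse is (8.10) (`Section8FrontEnd810.eq810_holds`) inside L3-t4's
  abstract assembly `Ranges1422.range_assembly_bound₃`; the weights are `Σ(n/φ(n))⁷/n ≪ 𝓛⁹`
  (whole range) and `≪ 𝓛^{1.1}` (window), `Skeleton.sum_ratio_pow_div_le`.

Total error `≪_{c′} 𝓛⁻¹⁰ = o(α)` (`α = π𝓛⁻⁹`). Theorem-only: 0 definitions, 0 named facts.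

## References

* Y. Zhang, arXiv:2211.02515v1 (2022), §10 p. 60, Remark p. 57, Lemma 10.2; §8 Lemmas 8.2–8.4,
  (8.10). [cite: Zhang2022LandauSiegel, §10 p. 60]
-/

noncomputable section

open Complex Real ComplexConjugate Finset
open Literature.NumberTheory.LFunctions.Zhang2022.Skeleton
open Literature.NumberTheory.LFunctions.Zhang2022.Typed.Sec10B (yShift frakv2S)

namespace Literature.NumberTheory.LFunctions.Zhang2022.Typed.Sec10C

namespace Low1214

open Ranges1422

/-! ## Part P. Parameter facts -/

section Params

variable {D : ℕ}

/-- `P > 0`. [cite: Zhang2022LandauSiegel, §2 (2.6)] -/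
private theorem bigP_pos₀ (D : ℕ) : 0 < bigP D := Real.exp_pos _

/-- `log P = 𝓛⁹`. [cite: Zhang2022LandauSiegel, §2 (2.6)] -/
private theorem log_bigP₀ (D : ℕ) : Real.log (bigP D) = ell D ^ 9 := by rw [bigP, Real.log_exp]

/-- `log P^a = a𝓛⁹`. [cite: Zhang2022LandauSiegel, §2 (2.6)] -/
private theorem log_bigP_rpow₀ (D : ℕ) (a : ℝ) : Real.log (bigP D ^ a) = a * ell D ^ 9 := by
  rw [Real.log_rpow (bigP_pos₀ D), log_bigP₀]

/-- `P^a > 0`. [cite: Zhang2022LandauSiegel, §2 (2.6)] -/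
private theorem rpow_pos₀ (D : ℕ) (a : ℝ) : 0 < bigP D ^ a := Real.rpow_pos_of_pos (bigP_pos₀ D) a

/-- `log T = 𝓛^{1.1}`. [cite: Zhang2022LandauSiegel, §6 p. 30] -/
private theorem log_bigT₀ (D : ℕ) : Real.log (bigT D) = ell D ^ (1.1 : ℝ) := by
  rw [Skeleton.bigT, Real.log_exp]

/-- The threshold: `D ≥ ⌈e^{M}⌉ ⇒ 𝓛 ≥ M`. [cite: Zhang2022LandauSiegel, §2 p. 4] -/
private theorem le_ell_of_ceil_exp_le₀ {M : ℝ} (hD : ⌈Real.exp M⌉₊ ≤ D) : M ≤ ell D := by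
  have h1 : Real.exp M ≤ (D : ℝ) := le_trans (Nat.le_ceil _) (by exact_mod_cast hD)
  have h2 := Real.log_le_log (Real.exp_pos _) h1
  rwa [Real.log_exp] at h2

/-- Range facts of the low range for `𝓛 ≥ 5`: `2 ≤ P^{0.496}/T`, `P^{0.496} ≤ P₃/T`,
`P^{0.496} ≤ P₂/T`, `P^{0.496} ≤ P^{0.5}`, `P^{0.496} < PT⁻²`, `P^{0.496} < P₁`, and
`n < P^{0.496} ⇒ n < ⌈PT⁻²⌉`. [cite: Zhang2022LandauSiegel, §10 p. 60] -/
theorem low_range_facts (hℓ : 5 ≤ ell D) :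
    2 ≤ bigP D ^ (0.496 : ℝ) / bigT D ∧
      bigP D ^ (0.496 : ℝ) ≤ Skeleton.P3 D / bigT D ∧
      bigP D ^ (0.496 : ℝ) ≤ Skeleton.P2 D / bigT D ∧
      bigP D ^ (0.496 : ℝ) ≤ bigP D ^ (0.5 : ℝ) ∧
      bigP D ^ (0.496 : ℝ) < bigP D / bigT D ^ 2 ∧
      bigP D ^ (0.496 : ℝ) < Skeleton.P1 D ∧
      (∀ n : ℕ, (n : ℝ) < bigP D ^ (0.496 : ℝ) → n < Nsupp D) := by
  have hℓ3 : 3 ≤ ell D := by linarith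
  have hℓ1 : 1 ≤ ell D := by linarith
  have hℓ0 : 0 < ell D := by linarith
  have hP := bigP_pos₀ D
  have hT : 0 < bigT D := Real.exp_pos _
  have h11 : ell D ^ (1.1 : ℝ) ≤ ell D ^ 2 := by
    have h := Real.rpow_le_rpow_of_exponent_le hℓ1 (show (1.1 : ℝ) ≤ 2 by norm_num)
    rwa [Real.rpow_two] at h
  obtain ⟨-, -, -, -, h504, -, hN⟩ := range_facts (D := D) hℓ3
  have hP1 : 1 ≤ bigP D := by
    have := Real.one_le_exp (show (0:ℝ) ≤ ell D ^ 9 by positivity); rwa [bigP]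
  have mono : ∀ a b : ℝ, a ≤ b → bigP D ^ a ≤ bigP D ^ b := fun a b hab =>
    Real.rpow_le_rpow_of_exponent_le hP1 hab
  -- `T ≤ P^{0.002}/2`: `log T = 𝓛^{1.1} ≤ 𝓛²`, `0.002𝓛⁹ − log 2 ≥ 𝓛²` for `𝓛 ≥ 5`
  have hT2 : 2 * bigT D ≤ bigP D ^ (0.002 : ℝ) := by
    rw [Skeleton.bigT, bigP, ← Real.exp_mul]
    have hlog2 : Real.log 2 ≤ 1 := by have := Real.log_two_lt_d9; linarith
    have h7 : (5 : ℝ) ^ 7 ≤ ell D ^ 7 := pow_le_pow_left₀ (by norm_num) hℓ 7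
    have hkey : Real.log 2 + ell D ^ (1.1 : ℝ) ≤ ell D ^ 9 * 0.002 := by
      have : ell D ^ 2 + 1 ≤ ell D ^ 9 * 0.002 := by nlinarith [pow_nonneg hℓ0.le 2]
      linarith
    calc 2 * Real.exp (ell D ^ (1.1 : ℝ)) = Real.exp (Real.log 2 + ell D ^ (1.1 : ℝ)) := by
          rw [Real.exp_add, Real.exp_log (by norm_num)]
      _ ≤ Real.exp (ell D ^ 9 * 0.002) := Real.exp_le_exp.mpr hkey
  -- `T¹¹ ≤ P^{0.004}`
  have hT11 : bigT D ^ 11 ≤ bigP D ^ (0.004 : ℝ) := by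
    rw [Skeleton.bigT, bigP, ← Real.exp_mul, ← Real.exp_nat_mul]
    refine Real.exp_le_exp.mpr ?_
    have h7 : (5 : ℝ) ^ 7 ≤ ell D ^ 7 := pow_le_pow_left₀ (by norm_num) hℓ 7
    push_cast
    nlinarith [pow_nonneg hℓ0.le 2]
  refine ⟨?_, ?_, ?_, mono _ _ (by norm_num), ?_, ?_, fun n hn => hN n (hn.trans_le (mono _ _ (by norm_num)))⟩
  · -- `2 ≤ P^{0.496}/T`: `2T ≤ P^{0.002} ≤ P^{0.496}`
    rw [le_div_iff₀ hT]
    calc 2 * bigT D ≤ bigP D ^ (0.002 : ℝ) := hT2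
      _ ≤ bigP D ^ (0.496 : ℝ) := mono _ _ (by norm_num)
  · -- `P^{0.496} ≤ P₃/T = P^{0.498}/T`
    rw [Skeleton.P3, le_div_iff₀ hT]
    calc bigP D ^ (0.496 : ℝ) * bigT D ≤ bigP D ^ (0.496 : ℝ) * bigP D ^ (0.002 : ℝ) := by
          have := (rpow_pos₀ D 0.496).le
          nlinarith
      _ = bigP D ^ (0.498 : ℝ) := by rw [← Real.rpow_add hP]; norm_num
  · -- `P^{0.496} ≤ P₂/T = P^{0.5}T^{-11}`
    rw [Skeleton.P2, le_div_iff₀ hT, le_div_iff₀ (pow_pos hT 10)]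
    calc bigP D ^ (0.496 : ℝ) * bigT D * bigT D ^ 10 = bigP D ^ (0.496 : ℝ) * bigT D ^ 11 := by ring
      _ ≤ bigP D ^ (0.496 : ℝ) * bigP D ^ (0.004 : ℝ) := by
          have := (rpow_pos₀ D 0.496).le
          nlinarith
      _ = bigP D ^ (0.5 : ℝ) := by rw [← Real.rpow_add hP]; norm_num
  · exact lt_of_lt_of_le (by
      calc bigP D ^ (0.496 : ℝ) < bigP D ^ (0.504 : ℝ) :=
            Real.rpow_lt_rpow_of_exponent_lt (by
              rw [bigP]; exact Real.one_lt_exp_iff.mpr (by positivity)) (by norm_num)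
        _ ≤ bigP D / bigT D ^ 2 := h504) le_rfl
  · rw [Skeleton.P1]
    exact Real.rpow_lt_rpow_of_exponent_lt (by
      rw [bigP]; exact Real.one_lt_exp_iff.mpr (by positivity)) (by norm_num)

/-- `log P₃ = 0.498 log P` and `P₃ = P^{0.498}`. [cite: Zhang2022LandauSiegel, §2 (2.21)] -/
theorem P3_facts (D : ℕ) :
    Skeleton.P3 D = bigP D ^ (0.498 : ℝ) ∧
      Real.log (Skeleton.P3 D) = 0.498 * Real.log (bigP D) :=
  ⟨rfl, by rw [Skeleton.P3, Real.log_rpow (bigP_pos₀ D)]⟩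

end Params

/-! ## Part F. The printed profile: `P₂ → P^{1/2}` swap for `𝔣_{j7}` -/

section Profiles

variable (c' : ℝ) {D : ℕ}

/-- **The printed profile swap**: for `1 ≤ m ≤ P^{0.496}`,
`‖𝔣_{j7}(P₂/m)/log P₂ − 𝔣_{j7}(P^{0.5}/m)/(0.5 log P)‖ ≤ 9000·𝓛⁻¹⁶`
(the Lipschitz step and `1/log P₂ − 2/log P = 10𝓛^{1.1}/(log P₂·0.5𝓛⁹)`, `log P₂ ≥ 0.4𝓛⁹`,
`𝓛^{1.1} ≤ 𝓛²`). [cite: Zhang2022LandauSiegel, §10 p. 60] -/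
theorem norm_F7swap_le (hℓ : 3 ≤ ell D) (hc5 : 5 * |c'| * alpha D * ell D ≤ 1) (j : ℕ)
    {m : ℝ} (hm1 : 1 ≤ m) (hmP : m ≤ bigP D ^ (0.496 : ℝ)) :
    ‖frakfW c' D j 7 (Skeleton.P2 D / m) / (Real.log (Skeleton.P2 D) : ℂ) -
        frakfW c' D j 7 (bigP D ^ (0.5 : ℝ) / m) / (0.5 * (Real.log (bigP D) : ℂ))‖ ≤
      9000 * (ell D ^ 16)⁻¹ := by
  obtain ⟨hα, hαeq, hαℓ⟩ := alpha_facts hℓ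
  have hℓ0 : 0 < ell D := by linarith
  have hℓ1 : 1 ≤ ell D := by linarith
  have hP := bigP_pos₀ D
  have hP1 : 1 ≤ bigP D := by
    have := Real.one_le_exp (show (0:ℝ) ≤ ell D ^ 9 by positivity); rwa [bigP]
  have mono : ∀ a b : ℝ, a ≤ b → bigP D ^ a ≤ bigP D ^ b := fun a b hab =>
    Real.rpow_le_rpow_of_exponent_le hP1 hab
  have h5P : bigP D ^ (0.5 : ℝ) ≤ bigP D := by
    calc bigP D ^ (0.5 : ℝ) ≤ bigP D ^ (1 : ℝ) := mono _ _ (by norm_num)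
      _ = bigP D := Real.rpow_one _
  have hm5 : m ≤ bigP D ^ (0.5 : ℝ) := hmP.trans (mono _ _ (by norm_num))
  have hmPP : m ≤ bigP D := hm5.trans h5P
  have h11 : ell D ^ (1.1 : ℝ) ≤ ell D ^ 2 := by
    have h := Real.rpow_le_rpow_of_exponent_le hℓ1 (show (1.1 : ℝ) ≤ 2 by norm_num)
    rwa [Real.rpow_two] at h
  have h11pos : 0 ≤ ell D ^ (1.1 : ℝ) := Real.rpow_nonneg hℓ0.le _
  -- the two denominators
  set p : ℝ := Real.log (Skeleton.P2 D) with hp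
  set q : ℝ := 0.5 * Real.log (bigP D) with hq
  have hpq : q - p = 10 * ell D ^ (1.1 : ℝ) := by rw [hp, hq, log_P2_eq, log_bigP₀]; ring
  obtain ⟨hplo, hphi⟩ := log_P2_bounds (D := D) hℓ
  have hp0 : 0 < p := log_P2_pos hℓ
  have hq9 : q = 0.5 * ell D ^ 9 := by rw [hq, log_bigP₀]
  have hq0 : 0 < q := by rw [hq9]; positivity
  have hpC : (p : ℂ) ≠ 0 := by exact_mod_cast hp0.ne'
  have hqC : (q : ℂ) ≠ 0 := by exact_mod_cast hq0.ne'
  set A : ℂ := frakfW c' D j 7 (Skeleton.P2 D / m)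
  set B : ℂ := frakfW c' D j 7 (bigP D ^ (0.5 : ℝ) / m)
  have hAB : ‖A - B‖ ≤ 94 * alpha D * (10 * ell D ^ (1.1 : ℝ)) :=
    Sec12C.norm_frakfW7_P2_sub_le c' hℓ hc5 j hm1 hm5
  have hB : ‖B‖ ≤ 29 := Sec12C.norm_frakfW_div_le c' hℓ hc5 j 7 (Real.one_le_rpow hP1 (by norm_num)) h5P hm1 hmPP
  have hqcast : (0.5 * (Real.log (bigP D) : ℂ)) = (q : ℂ) := by rw [hq]; push_cast; ring
  rw [hqcast]
  have e : A / (p : ℂ) - B / (q : ℂ) = (A - B) / (p : ℂ) + B * (((q - p : ℝ) : ℂ) / ((p : ℂ) * (q : ℂ))) := by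
    push_cast
    field_simp
    ring
  rw [e]
  have t1 : ‖(A - B) / (p : ℂ)‖ ≤ 94 * alpha D * (10 * ell D ^ (1.1 : ℝ)) / (0.4 * ell D ^ 9) := by
    rw [norm_div, Complex.norm_real, Real.norm_of_nonneg hp0.le]
    exact div_le_div₀ (by positivity) hAB (by positivity) hplo
  have t2 : ‖B * (((q - p : ℝ) : ℂ) / ((p : ℂ) * (q : ℂ)))‖ ≤
      29 * (10 * ell D ^ (1.1 : ℝ) / (0.4 * ell D ^ 9 * (0.5 * ell D ^ 9))) := by
    rw [norm_mul, norm_div, norm_mul, Complex.norm_real, Complex.norm_real, Complex.norm_real,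
      Real.norm_of_nonneg hp0.le, Real.norm_of_nonneg hq0.le, hpq,
      Real.norm_of_nonneg (by positivity)]
    refine mul_le_mul hB ?_ (by positivity) (by norm_num)
    rw [hq9]
    exact div_le_div_of_nonneg_left (by positivity) (by positivity) (by nlinarith)
  have hsum : 94 * alpha D * (10 * ell D ^ (1.1 : ℝ)) / (0.4 * ell D ^ 9) +
      29 * (10 * ell D ^ (1.1 : ℝ) / (0.4 * ell D ^ 9 * (0.5 * ell D ^ 9))) ≤ 9000 * (ell D ^ 16)⁻¹ := by
    rw [hαeq]
    have hπ := Real.pi_lt_d2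
    have e1 : 94 * (π / ell D ^ 9) * (10 * ell D ^ (1.1 : ℝ)) / (0.4 * ell D ^ 9) =
        2350 * π * ell D ^ (1.1 : ℝ) / ell D ^ 18 := by
      field_simp; ring
    have e2 : 29 * (10 * ell D ^ (1.1 : ℝ) / (0.4 * ell D ^ 9 * (0.5 * ell D ^ 9))) =
        1450 * ell D ^ (1.1 : ℝ) / ell D ^ 18 := by
      field_simp; ring
    rw [e1, e2, ← add_div]
    have hnum : 2350 * π * ell D ^ (1.1 : ℝ) + 1450 * ell D ^ (1.1 : ℝ) ≤ 9000 * ell D ^ 2 := by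
      nlinarith
    calc (2350 * π * ell D ^ (1.1 : ℝ) + 1450 * ell D ^ (1.1 : ℝ)) / ell D ^ 18
        ≤ 9000 * ell D ^ 2 / ell D ^ 18 := div_le_div_of_nonneg_right hnum (by positivity)
      _ = 9000 * (ell D ^ 16)⁻¹ := by field_simp
  exact (norm_add_le _ _).trans ((add_le_add t1 t2).trans hsum)

end Profiles

/-! ## Part M. The `m`-sum `mSum12`: Lemma 8.2 at `P₃/n`, `P₂/n` and the printed profile -/

section MSide

variable (c' : ℝ) {D : ℕ} [NeZero D] (χ : DirichletCharacter ℂ D)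

omit [NeZero D] in
/-- `mSum12` depends on `(d, r)` only through `dr`: `mSum12(n/r, r) = mSum12(n, 1)` for `r ∣ n`.
[cite: Zhang2022LandauSiegel, §10 p. 60] -/
theorem mSum12_div_mul (j : ℕ) {n r : ℕ} (hr : r ∣ n) :
    mSum12 c' χ j (n / r) r = mSum12 c' χ j n 1 := by
  unfold mSum12
  rw [Nat.div_mul_cancel hr, mul_one]

omit [NeZero D] in
/-- `mSum12(n,1) = ῑ₃Σ_m χ(m)ϰ₃(nm)m^{−(1−β_j)} + ῑ₄Σ_m χ(m)ϰ₂(nm)m^{−(1−β_j)}`.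
[cite: Zhang2022LandauSiegel, §10 p. 60] -/
theorem mSum12_one_eq (j n : ℕ) :
    mSum12 c' χ j n 1 =
      conj iota3 * (∑ m ∈ Finset.Ico 1 (Nsupp D),
          χ (m : ZMod D) * vk3 D (n * 1 * m) / (m : ℂ) ^ (1 - betaJ c' D j)) +
        conj iota4 * (∑ m ∈ Finset.Ico 1 (Nsupp D),
          χ (m : ZMod D) * vk2 D (n * 1 * m) / (m : ℂ) ^ (1 - betaJ c' D j)) := by
  unfold mSum12
  rw [Finset.mul_sum, Finset.mul_sum, ← Finset.sum_add_distrib]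
  refine Finset.sum_congr rfl fun m _ => ?_
  ring

omit [NeZero D] in
/-- `‖ῑ₃‖ ≤ 1.25`, `‖ῑ₄‖ ≤ 2.3`. [cite: Zhang2022LandauSiegel, §2 (2.26)] -/
theorem norm_conj_iota34_le : ‖conj iota3‖ ≤ 1.25 ∧ ‖conj iota4‖ ≤ 2.3 := by
  rw [Complex.norm_conj, Complex.norm_conj]; exact norm_iota34_le

/-- **The `m`-sum against the printed profile.** For `1 ≤ n ≤ P^{0.496}` (so `n < P₃/T`,
`n < P₂/T`), given Lemma 8.2's two evaluations at this `n` (bodies of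
`Section9Discharge.step9u002_sharp` and `Section8cStatements.Step8u041`, tolerances
`C₂𝓛⁻¹⁵`, `C₁𝓛⁻¹⁵`):
`‖mSum12(n,1) − (L′(1,χ)/log P)(ῑ₃𝔣_{j6}(P^{0.498}/n)/0.498 + ῑ₄𝔣_{j7}(P^{0.5}/n)/0.5)‖
 ≤ (1.25C₂ + 2.3C₁)𝓛⁻¹⁵ + 2.3·9000·|L′(1,χ)|·𝓛⁻¹⁶` (`P₃ = P^{0.498}`, `log P₃ = 0.498 log P`
exactly; the `P₂ → P^{1/2}` swap `norm_F7swap_le`). [cite: Zhang2022LandauSiegel, §10 p. 60] -/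
theorem norm_mSum12_sub_main_le (hℓ : 3 ≤ ell D) (hc5 : 5 * |c'| * alpha D * ell D ≤ 1) (j : ℕ)
    {n : ℕ} (hn1 : 1 ≤ n) (hnP : (n : ℝ) ≤ bigP D ^ (0.496 : ℝ)) {C₁ C₂ : ℝ}
    (h3 : ‖(∑ m ∈ Finset.Ico 1 (Nsupp D),
            χ (m : ZMod D) * vk3 D (n * 1 * m) / (m : ℂ) ^ (1 - betaJ c' D j)) -
          deriv χ.LFunction 1 / (Real.log (Skeleton.P3 D) : ℂ) *
            frakfW c' D j 6 (Skeleton.P3 D / ((n * 1 : ℕ) : ℝ))‖ ≤ C₂ * (ell D ^ 15)⁻¹)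
    (h2 : ‖(∑ m ∈ Finset.Ico 1 (Nsupp D),
            χ (m : ZMod D) * vk2 D (n * 1 * m) / (m : ℂ) ^ (1 - betaJ c' D j)) -
          deriv χ.LFunction 1 / (Real.log (Skeleton.P2 D) : ℂ) *
            frakfW c' D j 7 (Skeleton.P2 D / ((n * 1 : ℕ) : ℝ))‖ ≤ C₁ * (ell D ^ 15)⁻¹) :
    ‖mSum12 c' χ j n 1 - deriv χ.LFunction 1 / (Real.log (bigP D) : ℂ) *
        (conj iota3 * frakfW c' D j 6 (bigP D ^ (0.498 : ℝ) / n) / 0.498 +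
          conj iota4 * frakfW c' D j 7 (bigP D ^ (0.5 : ℝ) / n) / 0.5)‖ ≤
      (1.25 * C₂ + 2.3 * C₁) * (ell D ^ 15)⁻¹ +
        2.3 * 9000 * ‖deriv χ.LFunction 1‖ * (ell D ^ 16)⁻¹ := by
  have hℓ0 : 0 < ell D := by linarith
  have hn1R : (1 : ℝ) ≤ n := by exact_mod_cast hn1
  have hncast : ((n * 1 : ℕ) : ℝ) = (n : ℝ) := by push_cast; ring
  rw [hncast] at h3 h2
  obtain ⟨hP3, hlogP3⟩ := P3_facts D
  have hΛ : Real.log (bigP D) = ell D ^ 9 := log_bigP₀ D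
  have hΛpos : 0 < Real.log (bigP D) := by rw [hΛ]; positivity
  have hΛC : (Real.log (bigP D) : ℂ) ≠ 0 := by exact_mod_cast hΛpos.ne'
  have hP2C : (Real.log (Skeleton.P2 D) : ℂ) ≠ 0 := by exact_mod_cast (log_P2_pos hℓ).ne'
  -- abbreviations
  set L1 : ℂ := deriv χ.LFunction 1 with hL1
  set S₃ := ∑ m ∈ Finset.Ico 1 (Nsupp D),
    χ (m : ZMod D) * vk3 D (n * 1 * m) / (m : ℂ) ^ (1 - betaJ c' D j) with hS₃
  set S₂ := ∑ m ∈ Finset.Ico 1 (Nsupp D),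
    χ (m : ZMod D) * vk2 D (n * 1 * m) / (m : ℂ) ^ (1 - betaJ c' D j) with hS₂
  set F6 : ℂ := frakfW c' D j 6 (bigP D ^ (0.498 : ℝ) / n) with hF6
  set F7 : ℂ := frakfW c' D j 7 (bigP D ^ (0.5 : ℝ) / n) with hF7
  set F7' : ℂ := frakfW c' D j 7 (Skeleton.P2 D / n) with hF7'
  set E₃ : ℂ := S₃ - L1 / (Real.log (Skeleton.P3 D) : ℂ) * F6 with hE₃
  set E₂ : ℂ := S₂ - L1 / (Real.log (Skeleton.P2 D) : ℂ) * F7' with hE₂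
  set SW : ℂ := F7' / (Real.log (Skeleton.P2 D) : ℂ) - F7 / (0.5 * (Real.log (bigP D) : ℂ)) with hSW
  have hE₃n : ‖E₃‖ ≤ C₂ * (ell D ^ 15)⁻¹ := by rw [hE₃, hF6, ← hP3]; exact h3
  have hE₂n : ‖E₂‖ ≤ C₁ * (ell D ^ 15)⁻¹ := h2
  have hSWn : ‖SW‖ ≤ 9000 * (ell D ^ 16)⁻¹ := norm_F7swap_le c' hℓ hc5 j hn1R hnP
  have e : mSum12 c' χ j n 1 - L1 / (Real.log (bigP D) : ℂ) *
      (conj iota3 * F6 / 0.498 + conj iota4 * F7 / 0.5) =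
      conj iota3 * E₃ + conj iota4 * E₂ + conj iota4 * L1 * SW := by
    rw [mSum12_one_eq, hE₃, hE₂, hSW, hlogP3]
    push_cast
    field_simp
    ring
  rw [e]
  obtain ⟨hι3, hι4⟩ := norm_conj_iota34_le
  calc ‖conj iota3 * E₃ + conj iota4 * E₂ + conj iota4 * L1 * SW‖
      ≤ ‖conj iota3 * E₃‖ + ‖conj iota4 * E₂‖ + ‖conj iota4 * L1 * SW‖ := norm_add₃_le
    _ = ‖conj iota3‖ * ‖E₃‖ + ‖conj iota4‖ * ‖E₂‖ + ‖conj iota4‖ * ‖L1‖ * ‖SW‖ := by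
        rw [norm_mul, norm_mul, norm_mul, norm_mul]
    _ ≤ 1.25 * (C₂ * (ell D ^ 15)⁻¹) + 2.3 * (C₁ * (ell D ^ 15)⁻¹) +
          2.3 * ‖L1‖ * (9000 * (ell D ^ 16)⁻¹) := by
        gcongr
    _ = (1.25 * C₂ + 2.3 * C₁) * (ell D ^ 15)⁻¹ +
          2.3 * 9000 * ‖deriv χ.LFunction 1‖ * (ell D ^ 16)⁻¹ := by rw [hL1]; ring

/-- **Size of the printed `m`-profile**: for `1 ≤ n ≤ P^{0.496}`,
`‖(L′(1,χ)/log P)(ῑ₃𝔣_{j6}(P^{0.498}/n)/0.498 + ῑ₄𝔣_{j7}(P^{0.5}/n)/0.5)‖ ≤ 207·4e^{9/2}·𝓛⁻⁷`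
(`|L′| ≤ 4e^{9/2}𝓛²`, `|𝔣| ≤ 29`, `|ι₃| ≤ 1.25`, `|ι₄| ≤ 2.3`). [cite: Zhang2022LandauSiegel, §10 p. 60] -/
theorem norm_M0_le (hℓ : 3 ≤ ell D) (hp : χ.IsPrimitive) (hc5 : 5 * |c'| * alpha D * ell D ≤ 1)
    (j : ℕ) {n : ℕ} (hn1 : 1 ≤ n) (hnP : (n : ℝ) ≤ bigP D ^ (0.496 : ℝ)) :
    ‖deriv χ.LFunction 1 / (Real.log (bigP D) : ℂ) *
        (conj iota3 * frakfW c' D j 6 (bigP D ^ (0.498 : ℝ) / n) / 0.498 +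
          conj iota4 * frakfW c' D j 7 (bigP D ^ (0.5 : ℝ) / n) / 0.5)‖ ≤
      207 * (4 * Real.exp (9 / 2)) * (ell D ^ 7)⁻¹ := by
  have hℓ0 : 0 < ell D := by linarith
  have hn1R : (1 : ℝ) ≤ n := by exact_mod_cast hn1
  have hP1 : 1 ≤ bigP D := by
    have := Real.one_le_exp (show (0:ℝ) ≤ ell D ^ 9 by positivity); rwa [bigP]
  have mono : ∀ a b : ℝ, a ≤ b → bigP D ^ a ≤ bigP D ^ b := fun a b hab =>
    Real.rpow_le_rpow_of_exponent_le hP1 hab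
  have hle1 : ∀ a : ℝ, a ≤ 1 → bigP D ^ a ≤ bigP D := fun a ha => by
    calc bigP D ^ a ≤ bigP D ^ (1 : ℝ) := mono _ _ ha
      _ = bigP D := Real.rpow_one _
  have hnPP : (n : ℝ) ≤ bigP D := hnP.trans (hle1 _ (by norm_num))
  have hF6 := Sec12C.norm_frakfW_div_le c' hℓ hc5 j 6 (Real.one_le_rpow hP1 (by norm_num))
    (hle1 0.498 (by norm_num)) hn1R hnPP
  have hF7 := Sec12C.norm_frakfW_div_le c' hℓ hc5 j 7 (Real.one_le_rpow hP1 (by norm_num))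
    (hle1 0.5 (by norm_num)) hn1R hnPP
  have hL := norm_deriv_L_one_le χ hℓ hp
  have hΛ : ‖(Real.log (bigP D) : ℂ)‖ = ell D ^ 9 := by
    rw [Complex.norm_real, log_bigP₀, Real.norm_of_nonneg (by positivity)]
  obtain ⟨hι3, hι4⟩ := norm_conj_iota34_le
  have h1 : ‖conj iota3 * frakfW c' D j 6 (bigP D ^ (0.498 : ℝ) / n) / 0.498 +
      conj iota4 * frakfW c' D j 7 (bigP D ^ (0.5 : ℝ) / n) / 0.5‖ ≤ 207 := by
    have e498 : ‖(0.498 : ℂ)‖ = 0.498 := by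
      rw [show (0.498 : ℂ) = ((0.498 : ℝ) : ℂ) by norm_num]; rw [Complex.norm_real]; norm_num
    have e5 : ‖(0.5 : ℂ)‖ = 0.5 := by
      rw [show (0.5 : ℂ) = ((0.5 : ℝ) : ℂ) by norm_num]; rw [Complex.norm_real]; norm_num
    calc _ ≤ ‖conj iota3 * frakfW c' D j 6 (bigP D ^ (0.498 : ℝ) / n) / 0.498‖ +
          ‖conj iota4 * frakfW c' D j 7 (bigP D ^ (0.5 : ℝ) / n) / 0.5‖ := norm_add_le _ _
      _ = ‖conj iota3‖ * ‖frakfW c' D j 6 (bigP D ^ (0.498 : ℝ) / n)‖ / 0.498 +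
          ‖conj iota4‖ * ‖frakfW c' D j 7 (bigP D ^ (0.5 : ℝ) / n)‖ / 0.5 := by
          rw [norm_div, norm_div, norm_mul, norm_mul, e498, e5]
      _ ≤ 1.25 * 29 / 0.498 + 2.3 * 29 / 0.5 := by gcongr
      _ ≤ 207 := by norm_num
  rw [norm_mul, norm_div, hΛ]
  calc ‖deriv χ.LFunction 1‖ / ell D ^ 9 * ‖conj iota3 * frakfW c' D j 6 (bigP D ^ (0.498 : ℝ) / n) / 0.498 +
          conj iota4 * frakfW c' D j 7 (bigP D ^ (0.5 : ℝ) / n) / 0.5‖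
      ≤ (4 * Real.exp (9 / 2) * ell D ^ 2) / ell D ^ 9 * 207 := by gcongr
    _ = 207 * (4 * Real.exp (9 / 2)) * (ell D ^ 7)⁻¹ := by field_simp

end MSide

/-! ## Part N. The `n`-sum `frakv2S`: a crude bound valid on the whole low range -/

section NSide

variable (c' : ℝ) {D : ℕ} (χ : DirichletCharacter ℂ D)

/-- **Crude bound for a short shift-0 log-mean**: for `X < T`,
`‖Σ_{n≤X} χ(n)ξ₀ⱼ(n;d,r)n⁻¹log(X/n)‖ ≤ log T · Σ_{n<⌈T⌉} |ξ₀ⱼ(n;d,r)|/n` (for `X < 1` the mean is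
empty). [cite: Zhang2022LandauSiegel, §10 Lemma 10.2 (proof)] -/
theorem norm_logMean_short_le (hℓ : 3 ≤ ell D) (j d r : ℕ) {X : ℝ} (hX : X < bigT D) :
    ‖∑ n ∈ Finset.Ioc 0 ⌊X⌋₊, χ (n : ZMod D) * xiZero c' D j n d r / (n : ℂ) *
        (Real.log (X / n) : ℂ)‖ ≤
      Real.log (bigT D) * ∑ n ∈ Finset.Ico 1 ⌈bigT D⌉₊, ‖xiZero c' D j n d r‖ / n := by
  have hℓ0 : 0 < ell D := by linarith
  have hT1 : 1 ≤ bigT D := Real.one_le_exp (Real.rpow_nonneg hℓ0.le _)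
  have hlogT : 0 ≤ Real.log (bigT D) := Real.log_nonneg hT1
  have hS0 : 0 ≤ ∑ n ∈ Finset.Ico 1 ⌈bigT D⌉₊, ‖xiZero c' D j n d r‖ / n :=
    Finset.sum_nonneg fun n _ => by positivity
  rcases lt_or_ge X 1 with hX1 | hX1
  · rw [Lemma102.logMean_eq_zero_of_lt_one (fun n => χ (n : ZMod D) * xiZero c' D j n d r / (n : ℂ))
      hX1, norm_zero]
    positivity
  · have hX0 : 0 < X := by linarith
    have hsub : Finset.Ioc 0 ⌊X⌋₊ ⊆ Finset.Ico 1 ⌈bigT D⌉₊ := by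
      intro n hn
      rw [Finset.mem_Ioc] at hn
      rw [Finset.mem_Ico]
      refine ⟨hn.1, Nat.lt_ceil.mpr ?_⟩
      exact lt_of_le_of_lt ((Nat.cast_le.mpr hn.2).trans (Nat.floor_le hX0.le)) hX
    calc ‖∑ n ∈ Finset.Ioc 0 ⌊X⌋₊, χ (n : ZMod D) * xiZero c' D j n d r / (n : ℂ) *
          (Real.log (X / n) : ℂ)‖
        ≤ ∑ n ∈ Finset.Ioc 0 ⌊X⌋₊, ‖χ (n : ZMod D) * xiZero c' D j n d r / (n : ℂ) *
          (Real.log (X / n) : ℂ)‖ := norm_sum_le _ _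
      _ ≤ ∑ n ∈ Finset.Ioc 0 ⌊X⌋₊, Real.log (bigT D) * (‖xiZero c' D j n d r‖ / n) := by
          refine Finset.sum_le_sum fun n hn => ?_
          rw [Finset.mem_Ioc] at hn
          have hn0 : (0 : ℝ) < n := by exact_mod_cast hn.1
          have hn1 : (1 : ℝ) ≤ n := by exact_mod_cast hn.1
          have hnX : (n : ℝ) ≤ X := (Nat.cast_le.mpr hn.2).trans (Nat.floor_le hX0.le)
          have hlog0 : 0 ≤ Real.log (X / n) := Real.log_nonneg ((one_le_div hn0).mpr hnX)
          have hlogle : Real.log (X / n) ≤ Real.log (bigT D) := by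
            refine Real.log_le_log (div_pos hX0 hn0) ?_
            calc X / n ≤ X := div_le_self hX0.le hn1
              _ ≤ bigT D := hX.le
          rw [norm_mul, norm_div, norm_mul, Complex.norm_natCast, Complex.norm_real,
            Real.norm_of_nonneg hlog0]
          have hχ : ‖χ (n : ZMod D)‖ ≤ 1 := DirichletCharacter.norm_le_one χ _
          calc ‖χ (n : ZMod D)‖ * ‖xiZero c' D j n d r‖ / n * Real.log (X / n)
              ≤ 1 * ‖xiZero c' D j n d r‖ / n * Real.log (bigT D) := by gcongr
            _ = Real.log (bigT D) * (‖xiZero c' D j n d r‖ / n) := by ring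
      _ = Real.log (bigT D) * ∑ n ∈ Finset.Ioc 0 ⌊X⌋₊, ‖xiZero c' D j n d r‖ / n := by
          rw [Finset.mul_sum]
      _ ≤ Real.log (bigT D) * ∑ n ∈ Finset.Ico 1 ⌈bigT D⌉₊, ‖xiZero c' D j n d r‖ / n := by
          refine mul_le_mul_of_nonneg_left ?_ hlogT
          exact Finset.sum_le_sum_of_subset_of_nonneg hsub fun n _ _ => by positivity

variable [NeZero D]

/-- **The main value of a long shift-0 log-mean is `O(𝓛²(dr/φ(dr))²)`**: for `T ≤ X ≤ P`,
`‖L′(1,χ)Π(d,r)(1 + (β_{j+1}+β_{j+2})log X + ½β_{j+1}β_{j+2}log²X)‖ ≤ 110·4e^{9/2}𝓛²·(dr/φ(dr))²`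
(`|β| ≤ 4α`, `α log X ≤ π`, `|Π(d,r)| ≤ (dr/φ(dr))²`). [cite: Zhang2022LandauSiegel, §10 Lemma 10.2 (proof)] -/
theorem norm_logMean_main_le (hℓ : 3 ≤ ell D) (hp : χ.IsPrimitive)
    (hc5 : 5 * |c'| * alpha D * ell D ≤ 1) (j : ℕ) {d r : ℕ} (hd : 1 ≤ d) (hr : 1 ≤ r) {X : ℝ}
    (hX1 : 1 ≤ X) (hXP : X ≤ bigP D) :
    ‖deriv χ.LFunction 1 * PiW χ d r *
        (1 + (betaJ c' D (j + 1) + betaJ c' D (j + 2)) * (Real.log X : ℂ) +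
          betaJ c' D (j + 1) * betaJ c' D (j + 2) * (Real.log X : ℂ) ^ 2 / 2)‖ ≤
      110 * (4 * Real.exp (9 / 2)) * ell D ^ 2 * (((d * r : ℕ) : ℝ) / Nat.totient (d * r)) ^ 2 := by
  obtain ⟨hα, hαeq, hαℓ⟩ := alpha_facts hℓ
  have hℓ0 : 0 < ell D := by linarith
  obtain ⟨hl0, hl9⟩ := log_le_of_le_bigP hX1 hXP
  have hβ1 := Section8AbelProfiles.norm_betaJ_le c' hα.le hℓ0.le hc5 (j + 1)
  have hβ2 := Section8AbelProfiles.norm_betaJ_le c' hα.le hℓ0.le hc5 (j + 2)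
  have hL := norm_deriv_L_one_le χ hℓ hp
  have hPi := norm_PiW_le χ (d := d) (r := r) (by omega) (by omega)
  have hlogn : ‖(Real.log X : ℂ)‖ ≤ ell D ^ 9 := by
    rw [Complex.norm_real, Real.norm_of_nonneg hl0]; exact hl9
  have hquad : ‖1 + (betaJ c' D (j + 1) + betaJ c' D (j + 2)) * (Real.log X : ℂ) +
      betaJ c' D (j + 1) * betaJ c' D (j + 2) * (Real.log X : ℂ) ^ 2 / 2‖ ≤ 110 := by
    have hαl : alpha D * ell D ^ 9 = π := hαℓ
    calc _ ≤ ‖(1 : ℂ)‖ + ‖(betaJ c' D (j + 1) + betaJ c' D (j + 2)) * (Real.log X : ℂ)‖ +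
          ‖betaJ c' D (j + 1) * betaJ c' D (j + 2) * (Real.log X : ℂ) ^ 2 / 2‖ := norm_add₃_le
      _ ≤ 1 + (4 * alpha D + 4 * alpha D) * ell D ^ 9 +
          4 * alpha D * (4 * alpha D) * (ell D ^ 9) ^ 2 / 2 := by
          rw [norm_one, norm_mul, norm_div, norm_mul, norm_mul, norm_pow, Complex.norm_two]
          gcongr
          exact (norm_add_le _ _).trans (add_le_add hβ1 hβ2)
      _ = 1 + 8 * (alpha D * ell D ^ 9) + 8 * (alpha D * ell D ^ 9) ^ 2 := by ring
      _ = 1 + 8 * π + 8 * π ^ 2 := by rw [hαl]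
      _ ≤ 110 := by nlinarith [Real.pi_lt_d2, Real.pi_pos]
  rw [norm_mul, norm_mul]
  calc ‖deriv χ.LFunction 1‖ * ‖PiW χ d r‖ *
        ‖1 + (betaJ c' D (j + 1) + betaJ c' D (j + 2)) * (Real.log X : ℂ) +
          betaJ c' D (j + 1) * betaJ c' D (j + 2) * (Real.log X : ℂ) ^ 2 / 2‖
      ≤ (4 * Real.exp (9 / 2) * ell D ^ 2) * (((d * r : ℕ) : ℝ) / Nat.totient (d * r)) ^ 2 * 110 := by
        gcongr
    _ = 110 * (4 * Real.exp (9 / 2)) * ell D ^ 2 * (((d * r : ℕ) : ℝ) / Nat.totient (d * r)) ^ 2 := by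
        ring

/-- **Crude bound for the shifted `𝔳₂ⱼ`-sum, uniform on the low range.** For `d, r ≥ 1` with
`dr < P^{0.496}`, given LEMMA A at this `(j,d,r)` (Lemma 8.4 at shift `0`, relative, tolerance
`C_A𝓛⁻⁶(∏_{q∣dr}(1−q⁻¹)⁻¹)²` on `T ≤ x ≤ P`) and the log-free `ξ₀`-tail mean
(`Σ_{n<x}|ξ₀ⱼ|/n ≤ C₃(1 + log x)³`, `1 ≤ x ≤ T`):
`‖frakv2S‖ ≤ 2000(110·4e^{9/2}𝓛² + C_A + C₃𝓛^{1.1}(1 + 𝓛^{1.1})³)𝓛⁻⁹·(dr/φ(dr))²` — each of the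
three log-means of the shifted tent decomposition (`Lemma102.frakv2S_eq_logMeans`) is either long
(`≥ T`: LEMMA A + `norm_logMean_main_le`), short (`< T`: `norm_logMean_short_le`) or empty.
[cite: Zhang2022LandauSiegel, §10 Remark p. 57, Lemma 10.2 (proof)] -/
theorem norm_frakv2S_crude_le (hℓ : 5 ≤ ell D) (hp : χ.IsPrimitive)
    (hc5 : 5 * |c'| * alpha D * ell D ≤ 1) (j : ℕ) {d r : ℕ} (hd : 1 ≤ d) (hr : 1 ≤ r)
    {CA C₃ : ℝ} (hCA : 0 ≤ CA) (hC₃ : 0 ≤ C₃)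
    (hA : ∀ x : ℝ, bigT D ≤ x → x ≤ bigP D →
      ‖(∑ n ∈ Finset.Ioc 0 ⌊x⌋₊, χ (n : ZMod D) * xiZero c' D j n d r / (n : ℂ) *
            (Real.log (x / n) : ℂ)) -
          deriv χ.LFunction 1 * PiW χ d r *
            (1 + (betaJ c' D (j + 1) + betaJ c' D (j + 2)) * (Real.log x : ℂ) +
              betaJ c' D (j + 1) * betaJ c' D (j + 2) * (Real.log x : ℂ) ^ 2 / 2)‖ ≤
        CA * (ell D ^ 6)⁻¹ * (∏ q ∈ (d * r).primeFactors, (1 - (q : ℝ)⁻¹)⁻¹) ^ 2)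
    (h3 : ∀ x : ℝ, 1 ≤ x → x ≤ bigT D →
      ∑ n ∈ Finset.Ico 1 ⌈x⌉₊, ‖xiZero c' D j n d r‖ / n ≤ C₃ * (1 + Real.log x) ^ 3) :
    ‖frakv2S c' χ j d r‖ ≤
      2000 * (110 * (4 * Real.exp (9 / 2)) * ell D ^ 2 + CA +
          C₃ * ell D ^ (1.1 : ℝ) * (1 + ell D ^ (1.1 : ℝ)) ^ 3) / ell D ^ 9 *
        (((d * r : ℕ) : ℝ) / Nat.totient (d * r)) ^ 2 := by
  have hℓ3 : 3 ≤ ell D := by linarith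
  have hℓ1 : 1 ≤ ell D := by linarith
  have hℓ0 : 0 < ell D := by linarith
  have hD3 : 3 ≤ D := three_le_of_ell hℓ3
  have hD2 : 2 ≤ D := by omega
  have hP := bigP_pos₀ D
  have hP1 : 1 < bigP D := by rw [bigP]; exact Real.one_lt_exp_iff.mpr (by positivity)
  have hT1 : 1 ≤ bigT D := Real.one_le_exp (Real.rpow_nonneg hℓ0.le _)
  have hdr0 : d * r ≠ 0 := Nat.mul_ne_zero (by omega) (by omega)
  have hdr1 : (1 : ℝ) ≤ ((d * r : ℕ) : ℝ) := by exact_mod_cast Nat.one_le_iff_ne_zero.mpr hdr0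
  have hys1 : 1 ≤ yShift D ((d * r : ℕ) : ℝ) := hdr1.trans (Lemma102.le_yShift hℓ (by linarith))
  have hys0 : 0 < yShift D ((d * r : ℕ) : ℝ) := by linarith
  set ρ2 : ℝ := (((d * r : ℕ) : ℝ) / Nat.totient (d * r)) ^ 2 with hρ2
  have hρ2_1 : 1 ≤ ρ2 := one_le_pow₀ (one_le_self_div_totient hdr0)
  have hR : (∏ q ∈ (d * r).primeFactors, (1 - (q : ℝ)⁻¹)⁻¹) ^ 2 = ρ2 :=
    Sj1321Mid.prod_one_sub_inv_inv_sq_eq hdr0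
  set t : ℝ := ell D ^ (1.1 : ℝ) with ht
  have ht0 : 0 ≤ t := Real.rpow_nonneg hℓ0.le _
  have hlogT : Real.log (bigT D) = t := log_bigT₀ D
  set cL : ℝ := 4 * Real.exp (9 / 2) with hcL
  set BA : ℝ := 110 * cL * ell D ^ 2 + CA + C₃ * t * (1 + t) ^ 3 with hBA
  have hBA0 : 0 ≤ BA := by positivity
  -- the tail mean at `x = T`
  have h3T : ∑ n ∈ Finset.Ico 1 ⌈bigT D⌉₊, ‖xiZero c' D j n d r‖ / n ≤ C₃ * (1 + t) ^ 3 := by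
    rw [← hlogT]; exact h3 _ hT1 le_rfl
  -- every log-mean with `X ≤ P` is `≤ BA·ρ2`
  have hAX : ∀ X : ℝ, X ≤ bigP D →
      ‖∑ n ∈ Finset.Ioc 0 ⌊X⌋₊, χ (n : ZMod D) * xiZero c' D j n d r / (n : ℂ) *
          (Real.log (X / n) : ℂ)‖ ≤ BA * ρ2 := by
    intro X hXP
    by_cases hXT : bigT D ≤ X
    · have hX1 : 1 ≤ X := hT1.trans hXT
      have hmain := norm_logMean_main_le c' χ hℓ3 hp hc5 j hd hr hX1 hXP
      have hAx := hA X hXT hXP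
      rw [hR] at hAx
      have hsplit := norm_le_norm_add_norm_sub'
        (∑ n ∈ Finset.Ioc 0 ⌊X⌋₊, χ (n : ZMod D) * xiZero c' D j n d r / (n : ℂ) *
          (Real.log (X / n) : ℂ))
        (deriv χ.LFunction 1 * PiW χ d r *
          (1 + (betaJ c' D (j + 1) + betaJ c' D (j + 2)) * (Real.log X : ℂ) +
            betaJ c' D (j + 1) * betaJ c' D (j + 2) * (Real.log X : ℂ) ^ 2 / 2))
      have hℓ6 : CA * (ell D ^ 6)⁻¹ * ρ2 ≤ CA * ρ2 := by
        have : (ell D ^ 6)⁻¹ ≤ 1 := inv_le_one_of_one_le₀ (one_le_pow₀ hℓ1)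
        have h0 : 0 ≤ CA * ρ2 := by positivity
        nlinarith
      calc _ ≤ 110 * cL * ell D ^ 2 * ρ2 + CA * (ell D ^ 6)⁻¹ * ρ2 := by linarith
        _ ≤ 110 * cL * ell D ^ 2 * ρ2 + CA * ρ2 := by linarith
        _ ≤ BA * ρ2 := by
            rw [hBA]
            have : 0 ≤ C₃ * t * (1 + t) ^ 3 * ρ2 := by positivity
            nlinarith
    · rw [not_le] at hXT
      calc _ ≤ Real.log (bigT D) * ∑ n ∈ Finset.Ico 1 ⌈bigT D⌉₊, ‖xiZero c' D j n d r‖ / n :=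
            norm_logMean_short_le c' χ hℓ3 j d r hXT
        _ ≤ t * (C₃ * (1 + t) ^ 3) := by rw [hlogT]; exact mul_le_mul_of_nonneg_left h3T ht0
        _ ≤ BA * 1 := by
            rw [hBA, mul_one]
            have : 0 ≤ 110 * cL * ell D ^ 2 + CA := by positivity
            nlinarith
        _ ≤ BA * ρ2 := by gcongr
  -- the three means of the shifted tent decomposition
  rw [Lemma102.frakv2S_eq_logMeans χ c' j hd hr hP1 hD2 hys1]
  have hXle : ∀ a : ℝ, a ≤ 1 → bigP D ^ a / yShift D ((d * r : ℕ) : ℝ) ≤ bigP D := by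
    intro a ha
    calc bigP D ^ a / yShift D ((d * r : ℕ) : ℝ) ≤ bigP D ^ a := div_le_self (rpow_pos₀ D a).le hys1
      _ ≤ bigP D ^ (1 : ℝ) := Real.rpow_le_rpow_of_exponent_le hP1.le ha
      _ = bigP D := Real.rpow_one _
  have e1 := hAX _ (hXle 0.504 (by norm_num))
  have e2 := hAX _ (hXle 0.502 (by norm_num))
  have e3 := hAX _ (hXle 0.5 (by norm_num))
  have hΛ : Real.log (bigP D) = ell D ^ 9 := log_bigP₀ D
  have hpre : ‖((500 / Real.log (bigP D) : ℝ) : ℂ)‖ = 500 / ell D ^ 9 := by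
    rw [Complex.norm_real, hΛ, Real.norm_of_nonneg (by positivity)]
  rw [norm_mul, hpre]
  set A1 := ∑ n ∈ Finset.Ioc 0 ⌊bigP D ^ (0.504 : ℝ) / yShift D ((d * r : ℕ) : ℝ)⌋₊,
    χ (n : ZMod D) * xiZero c' D j n d r / (n : ℂ) *
      (Real.log (bigP D ^ (0.504 : ℝ) / yShift D ((d * r : ℕ) : ℝ) / n) : ℂ)
  set A2 := ∑ n ∈ Finset.Ioc 0 ⌊bigP D ^ (0.502 : ℝ) / yShift D ((d * r : ℕ) : ℝ)⌋₊,
    χ (n : ZMod D) * xiZero c' D j n d r / (n : ℂ) *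
      (Real.log (bigP D ^ (0.502 : ℝ) / yShift D ((d * r : ℕ) : ℝ) / n) : ℂ)
  set A3 := ∑ n ∈ Finset.Ioc 0 ⌊bigP D ^ (0.5 : ℝ) / yShift D ((d * r : ℕ) : ℝ)⌋₊,
    χ (n : ZMod D) * xiZero c' D j n d r / (n : ℂ) *
      (Real.log (bigP D ^ (0.5 : ℝ) / yShift D ((d * r : ℕ) : ℝ) / n) : ℂ)
  have hsum : ‖A1 - 2 * A2 + A3‖ ≤ 4 * (BA * ρ2) := by
    calc ‖A1 - 2 * A2 + A3‖ ≤ ‖A1 - 2 * A2‖ + ‖A3‖ := norm_add_le _ _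
      _ ≤ ‖A1‖ + ‖2 * A2‖ + ‖A3‖ := by gcongr; exact norm_sub_le _ _
      _ = ‖A1‖ + 2 * ‖A2‖ + ‖A3‖ := by rw [norm_mul, Complex.norm_two]
      _ ≤ BA * ρ2 + 2 * (BA * ρ2) + BA * ρ2 := by gcongr
      _ = 4 * (BA * ρ2) := by ring
  calc 500 / ell D ^ 9 * ‖A1 - 2 * A2 + A3‖ ≤ 500 / ell D ^ 9 * (4 * (BA * ρ2)) := by
        gcongr
    _ = 2000 * BA / ell D ^ 9 * ρ2 := by ring

end NSide

/-! ## Part R. The exact layer: re-indexing by `n = dr`, the index set, the collapsed main term -/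

section Reindex

variable (c' : ℝ) {D : ℕ} [NeZero D] (χ : DirichletCharacter ℂ D)

omit [NeZero D] in
/-- **Re-indexing `S1214On` by `n = dr`**: for a range `[lo, hi)` with `n < hi ⇒ n < ⌈PT⁻²⌉`,
`S1214On(j; lo, hi) = Σ_{lo≤n<hi} Σ_{r∣n, r squarefree} |χ(n)|λ₀ⱼ(n)n⁻¹φ(r)⁻¹ · mSum12(n,1) · nSum14(n/r, r)`.
[cite: Zhang2022LandauSiegel, §10 p. 60] -/
theorem S1214On_eq_divisor_sum (j : ℕ) {lo hi : ℝ} (hhi : ∀ n : ℕ, (n : ℝ) < hi → n < Nsupp D) :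
    S1214On c' χ j lo hi =
      ∑ n ∈ (Finset.Ico 1 (Nsupp D)).filter (fun n : ℕ => lo ≤ (n : ℝ) ∧ (n : ℝ) < hi),
        ∑ r ∈ n.divisors,
          (if Squarefree r then
            (‖χ (n : ZMod D)‖ : ℂ) * lamZero c' D j n / (n : ℂ) / (Nat.totient r : ℂ) *
              mSum12 c' χ j n 1 * nSum14 c' χ j (n / r) r else 0) := by
  classical
  unfold S1214On
  rw [Finset.sum_comm]
  rw [sum_box_ite_eq_sum_divisors (Nsupp D) (fun n : ℕ => lo ≤ (n : ℝ) ∧ (n : ℝ) < hi)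
    (fun n hn => hhi n hn.2) (fun d r => term1214 c' χ j d r)]
  refine Finset.sum_congr rfl fun n hn => Finset.sum_congr rfl fun r hr => ?_
  have hn0 : n ≠ 0 := by
    have := (Finset.mem_Ico.mp (Finset.mem_filter.mp hn).1).1; omega
  have hrd : r ∣ n := Nat.dvd_of_mem_divisors hr
  have hdr : n / r * r = n := Nat.div_mul_cancel hrd
  unfold term1214
  rw [norm_chi_mul_norm_moebius_chi χ (n / r) r]
  split_ifs with hsq
  · rw [mSum12_div_mul c' χ j hrd, hdr]
    ring
  · simp

omit [NeZero D] χ in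
/-- The filtered index set of the low range is `[1, ⌈P^{0.496}⌉)` (`𝓛 ≥ 5`).
[cite: Zhang2022LandauSiegel, §10 p. 60] -/
theorem lowSet_eq (hℓ : 5 ≤ ell D) :
    (Finset.Ico 1 (Nsupp D)).filter
        (fun n : ℕ => (0 : ℝ) ≤ (n : ℝ) ∧ (n : ℝ) < bigP D ^ (0.496 : ℝ)) =
      Finset.Ico 1 ⌈bigP D ^ (0.496 : ℝ)⌉₊ := by
  obtain ⟨-, -, -, -, -, -, hN⟩ := low_range_facts hℓ
  ext n
  simp only [Finset.mem_filter, Finset.mem_Ico]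
  constructor
  · rintro ⟨⟨h1, -⟩, -, hb⟩
    exact ⟨h1, Nat.lt_ceil.mpr hb⟩
  · rintro ⟨h1, hb⟩
    have hb' : (n : ℝ) < bigP D ^ (0.496 : ℝ) := Nat.lt_ceil.mp hb
    exact ⟨⟨h1, hN n hb'⟩, Nat.cast_nonneg n, hb'⟩

/-- **The collapsed main term IS the printed `n`-sum `lowSum1214`** (exact).
[cite: Zhang2022LandauSiegel, §10 p. 60] -/
theorem low_mainterm_eq (hℓ : 5 ≤ ell D) (j : ℕ) :
    ∑ n ∈ (Finset.Ico 1 (Nsupp D)).filter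
        (fun n : ℕ => (0 : ℝ) ≤ (n : ℝ) ∧ (n : ℝ) < bigP D ^ (0.496 : ℝ)),
      (‖χ (n : ZMod D)‖ : ℂ) * lamZero c' D j n / (n : ℂ) * ((n : ℂ) / (Nat.totient n : ℂ)) *
        (deriv χ.LFunction 1 / (Real.log (bigP D) : ℂ) *
            (conj iota3 * frakfW c' D j 6 (bigP D ^ (0.498 : ℝ) / n) / 0.498 +
              conj iota4 * frakfW c' D j 7 (bigP D ^ (0.5 : ℝ) / n) / 0.5) *
          (deriv χ.LFunction 1 * (betaJ c' D (j + 1) * betaJ c' D (j + 2)) *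
            (Real.log (bigP D) : ℂ) / 500) * 1) =
      lowSum1214 c' χ j := by
  have hℓ0 : 0 < ell D := by linarith
  rw [lowSet_eq hℓ]
  unfold lowSum1214 lamAvg
  rw [Nat.ceil_one, Finset.mul_sum]
  refine Finset.sum_congr rfl fun n hn => ?_
  have hn1 : 1 ≤ n := (Finset.mem_Ico.mp hn).1
  have hn0 : (n : ℂ) ≠ 0 := by exact_mod_cast (by omega : n ≠ 0)
  have hφ0 : (Nat.totient n : ℂ) ≠ 0 := by
    exact_mod_cast (Nat.totient_pos.mpr (by omega)).ne'
  have hΛ : (Real.log (bigP D) : ℂ) ≠ 0 := by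
    rw [log_bigP₀]; exact_mod_cast (pow_pos hℓ0 9).ne'
  field_simp

end Reindex

/-! ## Part A. The range assembly for the low range -/

section LowAssembly

variable (c' : ℝ) {D : ℕ} [NeZero D] (χ : DirichletCharacter ℂ D)

set_option maxHeartbeats 400000 in -- one long instantiation of `range_assembly_bound₃`
/-- **The range assembly for the low range.** At a modulus `D` (`𝓛 ≥ 5`) with the bodies of
Lemma 8.2 at `P₃/n` (`hU2`) and `P₂/n` (`hU1`), of the shifted relative (10.8) (`hS8`), of LEMMA A
(`hA`) and of the log-free `ξ₀`-tail mean (`h3`), the re-indexed low-range sum minus the collapsed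
main term is bounded by the weighted main-range (`y*(n) ≤ P^{0.5}/T`) and window contributions of
`Ranges1422.range_assembly_bound₃`. [cite: Zhang2022LandauSiegel, §10 p. 60] -/
theorem low_assembly_le (hℓ : 5 ≤ ell D) (hq : χ.IsQuadratic) (hp : χ.IsPrimitive)
    (hc5 : 5 * |c'| * alpha D * ell D ≤ 1) {C₁ C₂ CN CA C₃ : ℝ} (hC₁ : 0 ≤ C₁) (hC₂ : 0 ≤ C₂)
    (hCA : 0 ≤ CA) (hC₃ : 0 ≤ C₃)
    (hU2 : ∀ j ∈ ({1, 2, 3} : Finset ℕ), ∀ d r : ℕ, 1 ≤ d → 1 ≤ r →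
      ((d * r : ℕ) : ℝ) < Skeleton.P3 D / bigT D →
        ‖(∑ m ∈ Finset.Ico 1 (Nsupp D),
              χ (m : ZMod D) * vk3 D (d * r * m) / (m : ℂ) ^ (1 - betaJ c' D j)) -
            deriv χ.LFunction 1 / (Real.log (Skeleton.P3 D) : ℂ) *
              frakfW c' D j 6 (Skeleton.P3 D / ((d * r : ℕ) : ℝ))‖ ≤ C₂ * (ell D ^ 15)⁻¹)
    (hU1 : ∀ j ∈ ({1, 2, 3} : Finset ℕ), ∀ d r : ℕ, 1 ≤ d → 1 ≤ r →
      ((d * r : ℕ) : ℝ) < Skeleton.P2 D / bigT D →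
        ‖(∑ m ∈ Finset.Ico 1 (Nsupp D),
              χ (m : ZMod D) * vk2 D (d * r * m) / (m : ℂ) ^ (1 - betaJ c' D j)) -
            deriv χ.LFunction 1 / (Real.log (Skeleton.P2 D) : ℂ) *
              frakfW c' D j 7 (Skeleton.P2 D / ((d * r : ℕ) : ℝ))‖ ≤ C₁ * (ell D ^ 15)⁻¹)
    (hS8 : ∀ j ∈ ({1, 2, 3} : Finset ℕ), ∀ d r : ℕ, 1 ≤ d → 1 ≤ r →
      yShift D ((d * r : ℕ) : ℝ) ≤ bigP D ^ (0.5 : ℝ) / bigT D →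
        ‖frakv2S c' χ j d r - deriv χ.LFunction 1 * PiW χ d r / 500 *
            (betaJ c' D (j + 1) * betaJ c' D (j + 2)) * Real.log (bigP D)‖ ≤
          CN * (ell D ^ 15)⁻¹ * (∏ q ∈ (d * r).primeFactors, (1 - (q : ℝ)⁻¹)⁻¹) ^ 2)
    (hA : ∀ j ∈ ({1, 2, 3} : Finset ℕ), ∀ d r : ℕ, 1 ≤ d → 1 ≤ r →
      ((d * r : ℕ) : ℝ) < bigP D / bigT D ^ 2 → ∀ x : ℝ, bigT D ≤ x → x ≤ bigP D →
        ‖(∑ n ∈ Finset.Ioc 0 ⌊x⌋₊, χ (n : ZMod D) * xiZero c' D j n d r / (n : ℂ) *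
              (Real.log (x / n) : ℂ)) -
            deriv χ.LFunction 1 * PiW χ d r *
              (1 + (betaJ c' D (j + 1) + betaJ c' D (j + 2)) * (Real.log x : ℂ) +
                betaJ c' D (j + 1) * betaJ c' D (j + 2) * (Real.log x : ℂ) ^ 2 / 2)‖ ≤
          CA * (ell D ^ 6)⁻¹ * (∏ q ∈ (d * r).primeFactors, (1 - (q : ℝ)⁻¹)⁻¹) ^ 2)
    (h3 : ∀ j ∈ ({1, 2, 3} : Finset ℕ), ∀ d r : ℕ, 1 ≤ d → 1 ≤ r →
      ((d * r : ℕ) : ℝ) < Skeleton.P1 D → ∀ x : ℝ, 1 ≤ x → x ≤ bigT D →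
        ∑ n ∈ Finset.Ico 1 ⌈x⌉₊, ‖xiZero c' D j n d r‖ / n ≤ C₃ * (1 + Real.log x) ^ 3)
    {j : ℕ} (hj : j ∈ ({1, 2, 3} : Finset ℕ)) :
    ‖(∑ n ∈ (Finset.Ico 1 (Nsupp D)).filter
          (fun n : ℕ => (0 : ℝ) ≤ (n : ℝ) ∧ (n : ℝ) < bigP D ^ (0.496 : ℝ)),
        ∑ r ∈ n.divisors,
          (if Squarefree r then
            (‖χ (n : ZMod D)‖ : ℂ) * lamZero c' D j n / (n : ℂ) / (Nat.totient r : ℂ) *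
              mSum12 c' χ j n 1 * nSum14 c' χ j (n / r) r else 0)) -
      ∑ n ∈ (Finset.Ico 1 (Nsupp D)).filter
          (fun n : ℕ => (0 : ℝ) ≤ (n : ℝ) ∧ (n : ℝ) < bigP D ^ (0.496 : ℝ)),
        (‖χ (n : ZMod D)‖ : ℂ) * lamZero c' D j n / (n : ℂ) * ((n : ℂ) / (Nat.totient n : ℂ)) *
          (deriv χ.LFunction 1 / (Real.log (bigP D) : ℂ) *
              (conj iota3 * frakfW c' D j 6 (bigP D ^ (0.498 : ℝ) / n) / 0.498 +
                conj iota4 * frakfW c' D j 7 (bigP D ^ (0.5 : ℝ) / n) / 0.5) *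
            (deriv χ.LFunction 1 * (betaJ c' D (j + 1) * betaJ c' D (j + 2)) *
              (Real.log (bigP D) : ℂ) / 500) * 1)‖ ≤
      (∑ n ∈ ((Finset.Ico 1 (Nsupp D)).filter
          (fun n : ℕ => (0 : ℝ) ≤ (n : ℝ) ∧ (n : ℝ) < bigP D ^ (0.496 : ℝ))).filter
            (fun n : ℕ => yShift D (n : ℝ) ≤ bigP D ^ (0.5 : ℝ) / bigT D),
          ‖(‖χ (n : ZMod D)‖ : ℂ) * lamZero c' D j n / (n : ℂ)‖ * ((n : ℝ) / Nat.totient n) ^ 3) *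
          ((207 * (4 * Real.exp (9 / 2)) * (ell D ^ 7)⁻¹ +
                ((1.25 * C₂ + 2.3 * C₁) * (ell D ^ 15)⁻¹ +
                  2.3 * 9000 * ‖deriv χ.LFunction 1‖ * (ell D ^ 16)⁻¹)) *
              (CN * (ell D ^ 15)⁻¹) +
            ((1.25 * C₂ + 2.3 * C₁) * (ell D ^ 15)⁻¹ +
                  2.3 * 9000 * ‖deriv χ.LFunction 1‖ * (ell D ^ 16)⁻¹) *
              ‖deriv χ.LFunction 1 * (betaJ c' D (j + 1) * betaJ c' D (j + 2)) *
                  (Real.log (bigP D) : ℂ) / 500‖ * 1) +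
        (∑ n ∈ ((Finset.Ico 1 (Nsupp D)).filter
          (fun n : ℕ => (0 : ℝ) ≤ (n : ℝ) ∧ (n : ℝ) < bigP D ^ (0.496 : ℝ))).filter
            (fun n : ℕ => ¬ (yShift D (n : ℝ) ≤ bigP D ^ (0.5 : ℝ) / bigT D)),
          ‖(‖χ (n : ZMod D)‖ : ℂ) * lamZero c' D j n / (n : ℂ)‖ * ((n : ℝ) / Nat.totient n) ^ 3) *
          ((207 * (4 * Real.exp (9 / 2)) * (ell D ^ 7)⁻¹ +
                ((1.25 * C₂ + 2.3 * C₁) * (ell D ^ 15)⁻¹ +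
                  2.3 * 9000 * ‖deriv χ.LFunction 1‖ * (ell D ^ 16)⁻¹)) *
              (2000 * (110 * (4 * Real.exp (9 / 2)) * ell D ^ 2 + CA +
                  C₃ * ell D ^ (1.1 : ℝ) * (1 + ell D ^ (1.1 : ℝ)) ^ 3) / ell D ^ 9) +
            207 * (4 * Real.exp (9 / 2)) * (ell D ^ 7)⁻¹ *
              ‖deriv χ.LFunction 1 * (betaJ c' D (j + 1) * betaJ c' D (j + 2)) *
                  (Real.log (bigP D) : ℂ) / 500‖ * 1) := by
  classical
  have hℓ3 : 3 ≤ ell D := by linarith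
  have hℓ0 : 0 < ell D := by linarith
  obtain ⟨h2T, hP3T, hP2T, h4965, hPT2, hP1lt, hN⟩ := low_range_facts (D := D) hℓ
  have hT : 0 < bigT D := Real.exp_pos _
  set S := (Finset.Ico 1 (Nsupp D)).filter
      (fun n : ℕ => (0 : ℝ) ≤ (n : ℝ) ∧ (n : ℝ) < bigP D ^ (0.496 : ℝ)) with hSdef
  have memS : ∀ n ∈ S, 1 ≤ n ∧ (n : ℝ) < bigP D ^ (0.496 : ℝ) := by
    intro n hn
    rw [hSdef, Finset.mem_filter, Finset.mem_Ico] at hn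
    exact ⟨hn.1.1, hn.2.2⟩
  have hS0 : ∀ n ∈ S, n ≠ 0 := fun n hn => by have := (memS n hn).1; omega
  -- the per-`n` `m`-sum estimate on the whole range
  have hMn : ∀ n ∈ S, ‖mSum12 c' χ j n 1 - deriv χ.LFunction 1 / (Real.log (bigP D) : ℂ) *
      (conj iota3 * frakfW c' D j 6 (bigP D ^ (0.498 : ℝ) / n) / 0.498 +
        conj iota4 * frakfW c' D j 7 (bigP D ^ (0.5 : ℝ) / n) / 0.5)‖ ≤
      (1.25 * C₂ + 2.3 * C₁) * (ell D ^ 15)⁻¹ +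
        2.3 * 9000 * ‖deriv χ.LFunction 1‖ * (ell D ^ 16)⁻¹ := by
    intro n hn
    obtain ⟨hn1, hnP⟩ := memS n hn
    have hcast : ((n * 1 : ℕ) : ℝ) = (n : ℝ) := by push_cast; ring
    have hn3 : ((n * 1 : ℕ) : ℝ) < Skeleton.P3 D / bigT D := by rw [hcast]; linarith
    have hn2 : ((n * 1 : ℕ) : ℝ) < Skeleton.P2 D / bigT D := by rw [hcast]; linarith
    exact norm_mSum12_sub_main_le c' χ hℓ3 hc5 j hn1 hnP.le
      (hU2 j hj n 1 hn1 le_rfl hn3) (hU1 j hj n 1 hn1 le_rfl hn2)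
  refine range_assembly_bound₃ hS0
    (fun n : ℕ => yShift D (n : ℝ) ≤ bigP D ^ (0.5 : ℝ) / bigT D)
    (fun n => (‖χ (n : ZMod D)‖ : ℂ) * lamZero c' D j n / (n : ℂ))
    (fun n => mSum12 c' χ j n 1)
    (fun n => deriv χ.LFunction 1 / (Real.log (bigP D) : ℂ) *
      (conj iota3 * frakfW c' D j 6 (bigP D ^ (0.498 : ℝ) / n) / 0.498 +
        conj iota4 * frakfW c' D j 7 (bigP D ^ (0.5 : ℝ) / n) / 0.5))
    (fun _ => (1 : ℂ))
    (fun d r => nSum14 c' χ j d r) (fun d r => PiW χ d r)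
    (deriv χ.LFunction 1 * (betaJ c' D (j + 1) * betaJ c' D (j + 2)) *
      (Real.log (bigP D) : ℂ) / 500)
    (by positivity) (by positivity) (by positivity) ?_ ?_ ?_ ?_ ?_ ?_ ?_
  · -- hPi: (8.10)
    intro n hn _
    exact Section8FrontEnd810.eq810_holds D χ hq n (hS0 n hn)
  · -- hM: the `m`-sum on the main range (in fact everywhere)
    intro n hn _
    exact hMn n hn
  · -- hM₀
    intro n hn
    obtain ⟨hn1, hnP⟩ := memS n hn
    exact norm_M0_le c' χ hℓ3 hp hc5 j hn1 hnP.le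
  · -- hMW: `‖M‖ ≤ ‖M₀‖ + ‖M − M₀‖`
    intro n hn _
    obtain ⟨hn1, hnP⟩ := memS n hn
    have h1 := hMn n hn
    have h2 := norm_M0_le c' χ hℓ3 hp hc5 j hn1 hnP.le
    have h3' := norm_le_norm_add_norm_sub' (mSum12 c' χ j n 1)
      (deriv χ.LFunction 1 / (Real.log (bigP D) : ℂ) *
        (conj iota3 * frakfW c' D j 6 (bigP D ^ (0.498 : ℝ) / n) / 0.498 +
          conj iota4 * frakfW c' D j 7 (bigP D ^ (0.5 : ℝ) / n) / 0.5))
    linarith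
  · -- hG
    intro n _
    simp
  · -- hN: the shifted relative (10.8) on the main range
    intro n hn hmain r hr hsq
    obtain ⟨hn1, hnP⟩ := memS n hn
    have hrd : r ∣ n := Nat.dvd_of_mem_divisors hr
    have hr0 : r ≠ 0 := Nat.pos_iff_ne_zero.mp (Nat.pos_of_mem_divisors hr)
    have hr1 : 1 ≤ r := Nat.one_le_iff_ne_zero.mpr hr0
    have hdr : n / r * r = n := Nat.div_mul_cancel hrd
    have hd1 : 1 ≤ n / r := Nat.div_pos (Nat.le_of_dvd (by omega) hrd) (by omega)
    have hcast : ((n / r * r : ℕ) : ℝ) = n := by rw [hdr]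
    have hys : yShift D ((n / r * r : ℕ) : ℝ) ≤ bigP D ^ (0.5 : ℝ) / bigT D := by
      rw [hcast]; exact hmain
    have key := hS8 j hj (n / r) r hd1 hr1 hys
    rw [← Sec10C.nSum14_eq_frakv2S c' χ hℓ3 j hd1 hr1, hdr,
      Sj1321Mid.prod_one_sub_inv_inv_sq_eq (hS0 n hn)] at key
    have e : deriv χ.LFunction 1 * (betaJ c' D (j + 1) * betaJ c' D (j + 2)) *
        (Real.log (bigP D) : ℂ) / 500 * PiW χ (n / r) r * 1 =
        deriv χ.LFunction 1 * PiW χ (n / r) r / 500 *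
          (betaJ c' D (j + 1) * betaJ c' D (j + 2)) * Real.log (bigP D) := by ring
    rw [e]
    exact key
  · -- hW: the crude bound on the `y*`-window
    intro n hn _ r hr hsq
    obtain ⟨hn1, hnP⟩ := memS n hn
    have hrd : r ∣ n := Nat.dvd_of_mem_divisors hr
    have hr0 : r ≠ 0 := Nat.pos_iff_ne_zero.mp (Nat.pos_of_mem_divisors hr)
    have hr1 : 1 ≤ r := Nat.one_le_iff_ne_zero.mpr hr0
    have hdr : n / r * r = n := Nat.div_mul_cancel hrd
    have hd1 : 1 ≤ n / r := Nat.div_pos (Nat.le_of_dvd (by omega) hrd) (by omega)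
    have hcast : ((n / r * r : ℕ) : ℝ) = n := by rw [hdr]
    have hdrPT : ((n / r * r : ℕ) : ℝ) < bigP D / bigT D ^ 2 := by rw [hcast]; linarith
    have hdrP1 : ((n / r * r : ℕ) : ℝ) < Skeleton.P1 D := by rw [hcast]; linarith
    have key := norm_frakv2S_crude_le c' χ hℓ hp hc5 j hd1 hr1 hCA hC₃
      (hA j hj (n / r) r hd1 hr1 hdrPT) (h3 j hj (n / r) r hd1 hr1 hdrP1)
    rw [← Sec10C.nSum14_eq_frakv2S c' χ hℓ3 j hd1 hr1, hdr] at key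
    exact key

end LowAssembly

/-! ## Part W. Weights of the low range and of its `y*`-window -/

section LowWeights

variable (c' : ℝ) {D : ℕ} (χ : DirichletCharacter ℂ D)

/-- **Whole-range weight**: for `S′ ⊆ [1, ⌈P^{0.496}⌉)` and `𝓛 ≥ 5`,
`Σ_{n∈S′} ‖a(n)‖(n/φ(n))³ ≤ 4e^{256}𝓛⁹` (`Skeleton.sum_ratio_pow_div_le` at `k = 7` plus the term
`n = 1`). [cite: Zhang2022LandauSiegel, §10 p. 60] -/
theorem low_weights_all_le (hℓ : 5 ≤ ell D) (j : ℕ) {S' : Finset ℕ}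
    (hS' : S' ⊆ Finset.Ico 1 ⌈bigP D ^ (0.496 : ℝ)⌉₊) :
    ∑ n ∈ S', ‖(‖χ (n : ZMod D)‖ : ℂ) * lamZero c' D j n / (n : ℂ)‖ * ((n : ℝ) / Nat.totient n) ^ 3 ≤
      Real.exp 256 * (4 * ell D ^ 9) := by
  classical
  have hℓ1 : 1 ≤ ell D := by linarith
  have hℓ0 : 0 < ell D := by linarith
  obtain ⟨h2T, -⟩ := low_range_facts (D := D) hℓ
  have hT1 : 1 ≤ bigT D := Real.one_le_exp (Real.rpow_nonneg hℓ0.le _)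
  set v : ℝ := bigP D ^ (0.496 : ℝ) with hv
  have hv2 : 2 ≤ v := by
    have : v / bigT D ≤ v := div_le_self (rpow_pos₀ D _).le hT1
    linarith
  set N : ℕ := ⌈v⌉₊ with hN
  have hN2 : 2 ≤ N := by
    have : (2 : ℝ) ≤ N := hv2.trans (Nat.le_ceil v); exact_mod_cast this
  have hn0 : ∀ n ∈ S', n ≠ 0 := fun n hn => by
    have := (Finset.mem_Ico.mp (hS' hn)).1; omega
  have hsub : S' ⊆ insert 1 (Finset.Ioc 1 N) := by
    intro n hn
    have h := Finset.mem_Ico.mp (hS' hn)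
    rw [Finset.mem_insert, Finset.mem_Ioc]
    by_cases h1 : n = 1
    · left; exact h1
    · right; exact ⟨by omega, by omega⟩
  have hw0 : ∀ n : ℕ, 0 ≤ ((n : ℝ) / Nat.totient n) ^ 7 / n := fun n => by positivity
  have hIoc := sum_ratio_pow_div_le 7 (Y := 1) (X := N) one_pos (by omega)
  have e256 : Real.exp (2 ^ (7 + 1)) = Real.exp 256 := by norm_num
  rw [e256, Nat.cast_one, Real.log_one, sub_zero] at hIoc
  have hlogN : Real.log (N : ℝ) ≤ 1 + 0.496 * ell D ^ 9 := by
    have hN1 : (N : ℝ) ≤ 2 * v := by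
      have := Nat.ceil_lt_add_one (by linarith : (0 : ℝ) ≤ v); rw [← hN] at this; linarith
    have hlog2 : Real.log 2 ≤ 1 := by have := Real.log_two_lt_d9; linarith
    calc Real.log (N : ℝ) ≤ Real.log (2 * v) :=
          Real.log_le_log (by exact_mod_cast (by omega : 0 < N)) hN1
      _ = Real.log 2 + 0.496 * ell D ^ 9 := by
          rw [Real.log_mul (by norm_num) (by linarith), hv, log_bigP_rpow₀]
      _ ≤ 1 + 0.496 * ell D ^ 9 := by linarith
  have h1 : ((1 : ℕ) : ℝ) / Nat.totient 1 = 1 := by simp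
  calc ∑ n ∈ S', ‖(‖χ (n : ZMod D)‖ : ℂ) * lamZero c' D j n / (n : ℂ)‖ * ((n : ℝ) / Nat.totient n) ^ 3
      ≤ ∑ n ∈ S', ((n : ℝ) / Nat.totient n) ^ 7 / n :=
        Finset.sum_le_sum fun n hn => norm_weight_mul_cube_le c' χ j (hn0 n hn)
    _ ≤ ∑ n ∈ insert 1 (Finset.Ioc 1 N), ((n : ℝ) / Nat.totient n) ^ 7 / n :=
        Finset.sum_le_sum_of_subset_of_nonneg hsub fun n _ _ => hw0 n
    _ = 1 + ∑ n ∈ Finset.Ioc 1 N, ((n : ℝ) / Nat.totient n) ^ 7 / n := by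
        rw [Finset.sum_insert (by simp)]; simp
    _ ≤ 1 + Real.exp 256 * (1 + Real.log (N : ℝ)) := by linarith
    _ ≤ 1 + Real.exp 256 * (2 + 0.496 * ell D ^ 9) := by
        have := mul_le_mul_of_nonneg_left
          (show 1 + Real.log (N : ℝ) ≤ 2 + 0.496 * ell D ^ 9 by linarith) (Real.exp_pos 256).le
        linarith
    _ ≤ Real.exp 256 * (4 * ell D ^ 9) := by
        have he : 1 ≤ Real.exp 256 := Real.one_le_exp (by norm_num)
        have h9 : 1 ≤ ell D ^ 9 := one_le_pow₀ hℓ1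
        nlinarith

/-- **Window weight**: the `n < P^{0.496}` with `y*(n) > P^{0.5}/T` lie in `(P^{0.496}/T, P^{0.496}]`
(`y*(n) = nP^{0.004}/(Dt₀)`, `Dt₀ ≥ 1`), so their weight is `≤ e^{256}(3 + log T)`.
[cite: Zhang2022LandauSiegel, §10 p. 60] -/
theorem low_weights_window_le (hℓ : 5 ≤ ell D) (j : ℕ) {S' : Finset ℕ}
    (hS' : ∀ n ∈ S', (n : ℝ) < bigP D ^ (0.496 : ℝ) ∧
      ¬ (yShift D (n : ℝ) ≤ bigP D ^ (0.5 : ℝ) / bigT D)) :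
    ∑ n ∈ S', ‖(‖χ (n : ZMod D)‖ : ℂ) * lamZero c' D j n / (n : ℂ)‖ * ((n : ℝ) / Nat.totient n) ^ 3 ≤
      Real.exp 256 * (3 + ell D ^ (1.1 : ℝ)) := by
  have hℓ3 : 3 ≤ ell D := by linarith
  have hℓ0 : 0 < ell D := by linarith
  obtain ⟨h2T, -⟩ := low_range_facts (D := D) hℓ
  have hP := bigP_pos₀ D
  have hT : 0 < bigT D := Real.exp_pos _
  have hT1 : 1 ≤ bigT D := Real.one_le_exp (Real.rpow_nonneg hℓ0.le _)
  have hDt := Dt0_ge_one hℓ3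
  have hDt0 := Dt0_pos hℓ3
  set u : ℝ := bigP D ^ (0.496 : ℝ) / bigT D with hu
  set v : ℝ := bigP D ^ (0.496 : ℝ) with hv
  have huv : u ≤ v := div_le_self (rpow_pos₀ D _).le hT1
  have hwin : ∀ n ∈ S', u ≤ (n : ℝ) ∧ (n : ℝ) ≤ v := by
    intro n hn
    obtain ⟨hnv, hny⟩ := hS' n hn
    refine ⟨?_, hnv.le⟩
    rw [not_le] at hny
    -- `P^{0.5}/T < n P^{0.004}/(Dt₀)` ⇒ `P^{0.496}/T ≤ n`
    rw [Sec10B.yShift, lt_div_iff₀ hDt0] at hny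
    have h5 : bigP D ^ (0.5 : ℝ) = bigP D ^ (0.496 : ℝ) * bigP D ^ (0.004 : ℝ) := by
      rw [← Real.rpow_add hP]; norm_num
    have h004 := rpow_pos₀ D 0.004
    rw [hu, div_le_iff₀ hT]
    by_contra hcon
    rw [not_le] at hcon
    -- then `n·P^{0.004}·Dt₀... `: contradiction with hny
    have h1 : (n : ℝ) * bigP D ^ (0.004 : ℝ) * ((D : ℝ) * t0 D) <
        bigP D ^ (0.5 : ℝ) / bigT D * ((D : ℝ) * t0 D) := by
      rw [h5]
      have : (n : ℝ) * bigP D ^ (0.004 : ℝ) < bigP D ^ (0.496 : ℝ) * bigP D ^ (0.004 : ℝ) / bigT D := by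
        rw [lt_div_iff₀ hT]; nlinarith
      nlinarith
    have h2 : (n : ℝ) * bigP D ^ (0.004 : ℝ) ≤ (n : ℝ) * bigP D ^ (0.004 : ℝ) * ((D : ℝ) * t0 D) := by
      have : 0 ≤ (n : ℝ) * bigP D ^ (0.004 : ℝ) := by positivity
      nlinarith
    linarith
  refine (sum_weights_le c' χ j h2T huv hwin).trans ?_
  rw [hv, hu, Real.log_div (rpow_pos₀ D _).ne' hT.ne', log_bigT₀]
  linarith

end LowWeights

/-! ## Part Z. The final `o(α)` bookkeeping and the theorem -/

section Final

/-- `t = 𝓛^{1.1}` against `𝓛`: `1 ≤ t ≤ 𝓛²`, `t⁵ ≤ 𝓛⁶` (for `𝓛 ≥ 1`). [cite: Zhang2022LandauSiegel, §6 p. 30] -/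
private theorem t_facts {L : ℝ} (hL : 1 ≤ L) :
    1 ≤ L ^ (1.1 : ℝ) ∧ L ^ (1.1 : ℝ) ≤ L ^ 2 ∧ (L ^ (1.1 : ℝ)) ^ 5 ≤ L ^ 6 := by
  have hL0 : 0 ≤ L := by linarith
  refine ⟨Real.one_le_rpow hL (by norm_num), ?_, ?_⟩
  · have h := Real.rpow_le_rpow_of_exponent_le hL (show (1.1 : ℝ) ≤ 2 by norm_num)
    rwa [Real.rpow_two] at h
  · have e1 : (L ^ (1.1 : ℝ)) ^ 5 = L ^ (5.5 : ℝ) := by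
      rw [← Real.rpow_natCast, ← Real.rpow_mul hL0]; norm_num
    have e2 : L ^ 6 = L ^ (6 : ℝ) := by
      rw [show (6 : ℝ) = ((6 : ℕ) : ℝ) by norm_num, Real.rpow_natCast]
    rw [e1, e2]
    exact Real.rpow_le_rpow_of_exponent_le hL (by norm_num)

/-- The window factor: `(3 + t)(110c_L𝓛² + C_A + C₃t(1+t)³) ≤ (440c_L + 4C_A + 32C₃)𝓛⁶` for
`1 ≤ t ≤ 𝓛²`, `t⁵ ≤ 𝓛⁶`. [folklore] -/
private theorem window_factor_le {L t cL CA C₃ : ℝ} (hL : 1 ≤ L) (ht1 : 1 ≤ t) (ht2 : t ≤ L ^ 2)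
    (ht5 : t ^ 5 ≤ L ^ 6) (hcL : 0 ≤ cL) (hCA : 0 ≤ CA) (hC₃ : 0 ≤ C₃) :
    (3 + t) * (110 * cL * L ^ 2 + CA + C₃ * t * (1 + t) ^ 3) ≤
      (440 * cL + 4 * CA + 32 * C₃) * L ^ 6 := by
  have ht0 : 0 ≤ t := by linarith
  have h3t : 3 + t ≤ 4 * t := by linarith
  have h1t : (1 + t) ^ 3 ≤ 8 * t ^ 3 := by nlinarith [pow_le_pow_left₀ (by linarith : (0:ℝ) ≤ 1 + t) (by linarith : 1 + t ≤ 2 * t) 3]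
  have hL2 : L ^ 2 ≤ L ^ 6 := pow_le_pow_right₀ hL (by norm_num)
  have hL4 : L ^ 4 ≤ L ^ 6 := pow_le_pow_right₀ hL (by norm_num)
  have htL4 : t * L ^ 2 ≤ L ^ 4 := by nlinarith [pow_nonneg (by linarith : (0:ℝ) ≤ L) 2]
  have hA : (3 + t) * (110 * cL * L ^ 2) ≤ 440 * cL * L ^ 6 := by
    calc (3 + t) * (110 * cL * L ^ 2) ≤ 4 * t * (110 * cL * L ^ 2) := by gcongr
      _ = 440 * cL * (t * L ^ 2) := by ring
      _ ≤ 440 * cL * L ^ 6 := by gcongr; exact htL4.trans hL4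
  have hB : (3 + t) * CA ≤ 4 * CA * L ^ 6 := by
    calc (3 + t) * CA ≤ 4 * t * CA := by gcongr
      _ ≤ 4 * L ^ 2 * CA := by gcongr
      _ ≤ 4 * L ^ 6 * CA := by gcongr
      _ = 4 * CA * L ^ 6 := by ring
  have hC : (3 + t) * (C₃ * t * (1 + t) ^ 3) ≤ 32 * C₃ * L ^ 6 := by
    calc (3 + t) * (C₃ * t * (1 + t) ^ 3) ≤ 4 * t * (C₃ * t * (8 * t ^ 3)) := by gcongr
      _ = 32 * C₃ * t ^ 5 := by ring
      _ ≤ 32 * C₃ * L ^ 6 := by gcongr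
  nlinarith

/-- The final scalar inequality. [folklore] -/
private theorem final_arith {L ε e t Wm Ww B E N c W BM kBW kM CN kc kW : ℝ}
    (hL : 1 ≤ L) (hε : 0 < ε) (he0 : 0 ≤ e) (ht0 : 0 ≤ t) (ht2 : t ≤ L ^ 2)
    (hB0 : 0 ≤ B) (hE0 : 0 ≤ E) (hN0 : 0 ≤ N) (hc0 : 0 ≤ c) (hW0 : 0 ≤ W) (hBM0 : 0 ≤ BM)
    (hkBW : 0 ≤ kBW) (hkM : 0 ≤ kM) (hCN : 0 ≤ CN) (hkc : 0 ≤ kc) (hkW : 0 ≤ kW)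
    (hWm : Wm ≤ e * (4 * L ^ 9)) (hWw : Ww ≤ e * (3 + t))
    (hB : B ≤ kBW / L ^ 7) (hE : E ≤ kM / L ^ 14) (hN : N ≤ CN / L ^ 15) (hc : c ≤ kc / L ^ 7)
    (hW : (3 + t) * W ≤ kW / L ^ 3) (hBM : BM ≤ kBW / L ^ 7)
    (hbig : (e * (4 * kBW * CN + 4 * kM * kc + kBW * kW + 4 * kBW * kc)) / (ε * π) ≤ L) :
    Wm * (B * N + E * c * 1) + Ww * (B * W + BM * c * 1) ≤ ε * (π / L ^ 9) := by
  have hL0 : 0 < L := by linarith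
  have hπ : 0 < π := Real.pi_pos
  set K : ℝ := e * (4 * kBW * CN + 4 * kM * kc + kBW * kW + 4 * kBW * kc) with hK
  have hK0 : 0 ≤ K := by positivity
  -- monomial reductions `1/L^a ≤ 1/L^10`
  have hpow : ∀ a : ℕ, 10 ≤ a → (L ^ a)⁻¹ ≤ (L ^ 10)⁻¹ := fun a ha =>
    inv_anti₀ (pow_pos hL0 10) (pow_le_pow_right₀ hL ha)
  -- term 1: `Wm·B·N ≤ 4e kBW CN / L^13`
  have T1 : Wm * (B * N) ≤ e * (4 * kBW * CN) * (L ^ 10)⁻¹ := by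
    calc Wm * (B * N) ≤ (e * (4 * L ^ 9)) * ((kBW / L ^ 7) * (CN / L ^ 15)) := by gcongr
      _ = e * (4 * kBW * CN) * (L ^ 13)⁻¹ := by field_simp
      _ ≤ e * (4 * kBW * CN) * (L ^ 10)⁻¹ :=
          mul_le_mul_of_nonneg_left (hpow 13 (by norm_num)) (by positivity)
  -- term 2: `Wm·E·c ≤ 4e kM kc / L^12`
  have T2 : Wm * (E * c * 1) ≤ e * (4 * kM * kc) * (L ^ 10)⁻¹ := by
    calc Wm * (E * c * 1) = Wm * (E * c) := by ring
      _ ≤ (e * (4 * L ^ 9)) * ((kM / L ^ 14) * (kc / L ^ 7)) := by gcongr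
      _ = e * (4 * kM * kc) * (L ^ 12)⁻¹ := by field_simp
      _ ≤ e * (4 * kM * kc) * (L ^ 10)⁻¹ :=
          mul_le_mul_of_nonneg_left (hpow 12 (by norm_num)) (by positivity)
  -- term 3: `Ww·B·W ≤ e·B·(3+t)W ≤ e kBW kW / L^10`
  have T3 : Ww * (B * W) ≤ e * (kBW * kW) * (L ^ 10)⁻¹ := by
    calc Ww * (B * W) ≤ (e * (3 + t)) * (B * W) := by gcongr
      _ = e * (B * ((3 + t) * W)) := by ring
      _ ≤ e * ((kBW / L ^ 7) * (kW / L ^ 3)) := by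
          gcongr
      _ = e * (kBW * kW) * (L ^ 10)⁻¹ := by field_simp
  -- term 4: `Ww·BM·c ≤ e(3+t)·kBW/L^7·kc/L^7 ≤ 4e kBW kc L²/L^14`
  have T4 : Ww * (BM * c * 1) ≤ e * (4 * kBW * kc) * (L ^ 10)⁻¹ := by
    have h3t : 3 + t ≤ 4 * L ^ 2 := by nlinarith
    calc Ww * (BM * c * 1) = Ww * (BM * c) := by ring
      _ ≤ (e * (3 + t)) * ((kBW / L ^ 7) * (kc / L ^ 7)) := by gcongr
      _ ≤ (e * (4 * L ^ 2)) * ((kBW / L ^ 7) * (kc / L ^ 7)) := by gcongr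
      _ = e * (4 * kBW * kc) * (L ^ 12)⁻¹ := by field_simp
      _ ≤ e * (4 * kBW * kc) * (L ^ 10)⁻¹ :=
          mul_le_mul_of_nonneg_left (hpow 12 (by norm_num)) (by positivity)
  have htot : Wm * (B * N + E * c * 1) + Ww * (B * W + BM * c * 1) ≤ K * (L ^ 10)⁻¹ := by
    have e1 : Wm * (B * N + E * c * 1) + Ww * (B * W + BM * c * 1) =
        Wm * (B * N) + Wm * (E * c * 1) + Ww * (B * W) + Ww * (BM * c * 1) := by ring
    rw [e1, hK]
    nlinarith [T1, T2, T3, T4]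
  refine htot.trans ?_
  -- `K/L^10 ≤ επ/L^9 ⟸ K/(επ) ≤ L`
  have hKL : K ≤ ε * π * L := by
    have := (div_le_iff₀ (by positivity : (0:ℝ) < ε * π)).mp hbig
    linarith
  rw [show ε * (π / L ^ 9) = (ε * π * L) * (L ^ 10)⁻¹ by field_simp]
  exact mul_le_mul_of_nonneg_right hKL (by positivity)

variable {c' : ℝ}

/-- Threshold packaging: eventually `M ≤ 𝓛`. [cite: Zhang2022LandauSiegel, §2 p. 4] -/
private theorem forAllLarge_ell_ge (M : ℝ) : ForAllLarge fun D _ _ => M ≤ ell D := by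
  refine ⟨⌈Real.exp M⌉₊, fun D _ _ hD _ _ => le_ell_of_ceil_exp_le₀ hD⟩

set_option maxHeartbeats 400000 in -- the final assembly of five inputs and the `o(α)` bookkeeping
/-- **`Z22:§10.u055 (i)` holds** [Z22 p.60, tex L3081, first line]: `Typed.Sec10C.Low1214Eval c′` for
every `c′ ≥ 0` — "the sum over `dr < P^{0.496}` is equal to
`(L′(1,χ)²/500)β_{j+1}β_{j+2}Σ_{n<P^{0.496}}|χ(n)|λ₀ⱼ(n)φ(n)⁻¹(ῑ₃𝔣_{j6}(P^{0.498}/n)/0.498 + ῑ₄𝔣_{j7}(P^{0.5}/n)/0.5) + o(α)`"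
for the range sum `S1214On(0, P^{0.496})` of `S_j(𝐚₁₂,𝐚₁₄)`. PROVED OUTRIGHT (no manuscript claim
as hypothesis): Lemma 8.2 at `P₃/n`, `P₂/n` (tree, from `Skeleton.lemma82_holds`) for the `m`-sum,
the shifted relative (10.8) (`Lemma102.eq108SRel_of_logMean` at LEMMA A
`Lemma102.logMeanRel_of_lemma83Rel`, itself at `Skeleton.lemma83Rel_holds`) for the `n`-sum on
`y* ≤ P^{0.5}/T`, the crude bound `norm_frakv2S_crude_le` on the `y*`-window, (8.10) and the
abstract assembly `Ranges1422.range_assembly_bound₃`; total error `≪_{c′} 𝓛⁻¹⁰ = o(α)`.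
[cite: Zhang2022LandauSiegel, §10 p. 60] -/
theorem low1214Eval_holds (hc' : 0 ≤ c') : Low1214Eval c' := by
  intro ε hε
  -- the five inputs (all tree theorems)
  obtain ⟨C₂, hU2⟩ := Section9Discharge.step9u002_sharp c' (lemma82_holds hc')
  have h41 := Section8FrontEnd82.step8u041_holds hc'
  unfold Section8cStatements.Step8u041 at h41
  obtain ⟨C₁, hU1⟩ := h41
  obtain ⟨CA, hA⟩ := Lemma102.logMeanRel_of_lemma83Rel (lemma83Rel_holds c')
  obtain ⟨CN, hS8⟩ := Lemma102.eq108SRel_of_logMean (c' := c') ⟨CA, hA⟩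
  obtain ⟨C₃, h3⟩ := XiZeroMajorant.xiZeroTailMean_logFree c'
  -- the constants
  set cL : ℝ := 4 * Real.exp (9 / 2) with hcL
  set C₁p : ℝ := max C₁ 0 with hC₁p
  set C₂p : ℝ := max C₂ 0 with hC₂p
  set CAp : ℝ := max CA 0 with hCAp
  set CNp : ℝ := max CN 0 with hCNp
  set C₃p : ℝ := max C₃ 0 with hC₃p
  set kM : ℝ := 1.25 * C₂p + 2.3 * C₁p + 2.3 * 9000 * cL with hkM
  set kBW : ℝ := 207 * cL + kM with hkBW
  set kc : ℝ := cL * 4 * 4 * π * π / 500 with hkc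
  set kW : ℝ := 2000 * (440 * cL + 4 * CAp + 32 * C₃p) with hkW
  set K : ℝ := Real.exp 256 * (4 * kBW * CNp + 4 * kM * kc + kBW * kW + 4 * kBW * kc) with hK
  have hcL0 : 0 ≤ cL := by positivity
  have hkM0 : 0 ≤ kM := by positivity
  have hkBW0 : 0 ≤ kBW := by positivity
  have hkc0 : 0 ≤ kc := by positivity
  have hkW0 : 0 ≤ kW := by positivity
  have hK0 : 0 ≤ K := by positivity
  refine ((((((hU2.and hU1).and hS8).and hA).and h3).and (forAllLarge_five_c c')).and
    (forAllLarge_ell_ge (K / (ε * π) + 6))).mono ?_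
  intro D _ χ hq hp ⟨⟨⟨⟨⟨⟨hU2D, hU1D⟩, hS8D⟩, hAD⟩, h3D⟩, hD3, hℓ6, hc5⟩, hℓK⟩ hAss j hj
  have hℓ5 : 5 ≤ ell D := by linarith
  have hℓ3 : 3 ≤ ell D := by linarith
  have hℓ1 : 1 ≤ ell D := by linarith
  have hℓ0 : 0 < ell D := by linarith
  have hℓbig : K / (ε * π) ≤ ell D := by
    have : 0 ≤ (6 : ℝ) := by norm_num
    linarith
  obtain ⟨h2T, hP3T, hP2T, h4965, hPT2, hP1lt, hN⟩ := low_range_facts (D := D) hℓ5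
  -- the bodies at this modulus, with nonnegative constants
  have hU2' : ∀ j ∈ ({1, 2, 3} : Finset ℕ), ∀ d r : ℕ, 1 ≤ d → 1 ≤ r →
      ((d * r : ℕ) : ℝ) < Skeleton.P3 D / bigT D →
        ‖(∑ m ∈ Finset.Ico 1 (Nsupp D),
              χ (m : ZMod D) * vk3 D (d * r * m) / (m : ℂ) ^ (1 - betaJ c' D j)) -
            deriv χ.LFunction 1 / (Real.log (Skeleton.P3 D) : ℂ) *
              frakfW c' D j 6 (Skeleton.P3 D / ((d * r : ℕ) : ℝ))‖ ≤ C₂p * (ell D ^ 15)⁻¹ :=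
    fun j hj d r hd hr hdr => (hU2D hAss j hj d r hd hr hdr).trans
      (mul_le_mul_of_nonneg_right (le_max_left _ _) (by positivity))
  have hU1' : ∀ j ∈ ({1, 2, 3} : Finset ℕ), ∀ d r : ℕ, 1 ≤ d → 1 ≤ r →
      ((d * r : ℕ) : ℝ) < Skeleton.P2 D / bigT D →
        ‖(∑ m ∈ Finset.Ico 1 (Nsupp D),
              χ (m : ZMod D) * vk2 D (d * r * m) / (m : ℂ) ^ (1 - betaJ c' D j)) -
            deriv χ.LFunction 1 / (Real.log (Skeleton.P2 D) : ℂ) *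
              frakfW c' D j 7 (Skeleton.P2 D / ((d * r : ℕ) : ℝ))‖ ≤ C₁p * (ell D ^ 15)⁻¹ :=
    fun j hj d r hd hr hdr => (hU1D hAss j hj d r hd hr hdr).trans
      (mul_le_mul_of_nonneg_right (le_max_left _ _) (by positivity))
  have hS8' : ∀ j ∈ ({1, 2, 3} : Finset ℕ), ∀ d r : ℕ, 1 ≤ d → 1 ≤ r →
      yShift D ((d * r : ℕ) : ℝ) ≤ bigP D ^ (0.5 : ℝ) / bigT D →
        ‖frakv2S c' χ j d r - deriv χ.LFunction 1 * PiW χ d r / 500 *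
            (betaJ c' D (j + 1) * betaJ c' D (j + 2)) * Real.log (bigP D)‖ ≤
          CNp * (ell D ^ 15)⁻¹ * (∏ q ∈ (d * r).primeFactors, (1 - (q : ℝ)⁻¹)⁻¹) ^ 2 :=
    fun j hj d r hd hr hys => (hS8D hAss j hj d r hd hr hys).trans (by
      gcongr; exact le_max_left _ _)
  have hA' : ∀ j ∈ ({1, 2, 3} : Finset ℕ), ∀ d r : ℕ, 1 ≤ d → 1 ≤ r →
      ((d * r : ℕ) : ℝ) < bigP D / bigT D ^ 2 → ∀ x : ℝ, bigT D ≤ x → x ≤ bigP D →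
        ‖(∑ n ∈ Finset.Ioc 0 ⌊x⌋₊, χ (n : ZMod D) * xiZero c' D j n d r / (n : ℂ) *
              (Real.log (x / n) : ℂ)) -
            deriv χ.LFunction 1 * PiW χ d r *
              (1 + (betaJ c' D (j + 1) + betaJ c' D (j + 2)) * (Real.log x : ℂ) +
                betaJ c' D (j + 1) * betaJ c' D (j + 2) * (Real.log x : ℂ) ^ 2 / 2)‖ ≤
          CAp * (ell D ^ 6)⁻¹ * (∏ q ∈ (d * r).primeFactors, (1 - (q : ℝ)⁻¹)⁻¹) ^ 2 :=
    fun j hj d r hd hr hdr x hx1 hx2 => (hAD hAss j hj d r hd hr hdr x hx1 hx2).trans (by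
      gcongr; exact le_max_left _ _)
  have h3' : ∀ j ∈ ({1, 2, 3} : Finset ℕ), ∀ d r : ℕ, 1 ≤ d → 1 ≤ r →
      ((d * r : ℕ) : ℝ) < Skeleton.P1 D → ∀ x : ℝ, 1 ≤ x → x ≤ bigT D →
        ∑ n ∈ Finset.Ico 1 ⌈x⌉₊, ‖xiZero c' D j n d r‖ / n ≤ C₃p * (1 + Real.log x) ^ 3 :=
    fun j hj d r hd hr hdr x hx1 hx2 => (h3D j hj d r hd hr hdr x hx1 hx2).trans (by
      gcongr
      · have : 0 ≤ Real.log x := Real.log_nonneg hx1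
        positivity
      · exact le_max_left _ _)
  -- the exact layer
  rw [S1214On_eq_divisor_sum c' χ j hN, ← low_mainterm_eq c' χ hℓ5 j]
  refine (low_assembly_le c' χ hℓ5 hq hp hc5 (show 0 ≤ C₁p from le_max_right _ _)
    (show 0 ≤ C₂p from le_max_right _ _) (show 0 ≤ CAp from le_max_right _ _)
    (show 0 ≤ C₃p from le_max_right _ _) hU2' hU1' hS8' hA' h3' hj).trans ?_
  -- the weights
  set S := (Finset.Ico 1 (Nsupp D)).filter
      (fun n : ℕ => (0 : ℝ) ≤ (n : ℝ) ∧ (n : ℝ) < bigP D ^ (0.496 : ℝ)) with hSdef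
  have hSsub : S.filter (fun n : ℕ => yShift D (n : ℝ) ≤ bigP D ^ (0.5 : ℝ) / bigT D) ⊆
      Finset.Ico 1 ⌈bigP D ^ (0.496 : ℝ)⌉₊ := by
    intro n hn
    rw [Finset.mem_filter, hSdef, lowSet_eq hℓ5] at hn
    exact hn.1
  have hWm := low_weights_all_le c' χ hℓ5 j hSsub
  have hSwin : ∀ n ∈ S.filter (fun n : ℕ => ¬ (yShift D (n : ℝ) ≤ bigP D ^ (0.5 : ℝ) / bigT D)),
      (n : ℝ) < bigP D ^ (0.496 : ℝ) ∧ ¬ (yShift D (n : ℝ) ≤ bigP D ^ (0.5 : ℝ) / bigT D) := by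
    intro n hn
    rw [Finset.mem_filter, hSdef, Finset.mem_filter] at hn
    exact ⟨hn.1.2.2, hn.2⟩
  have hWw := low_weights_window_le c' χ hℓ5 j hSwin
  -- sizes
  obtain ⟨hα, hαeq, hαℓ⟩ := alpha_facts hℓ3
  obtain ⟨ht1, ht2, ht5⟩ := t_facts hℓ1
  set t : ℝ := ell D ^ (1.1 : ℝ) with ht
  have hL := norm_deriv_L_one_le χ hℓ3 hp
  have hβ1 := Section8AbelProfiles.norm_betaJ_le c' hα.le hℓ0.le hc5 (j + 1)
  have hβ2 := Section8AbelProfiles.norm_betaJ_le c' hα.le hℓ0.le hc5 (j + 2)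
  have hΛn : ‖((Real.log (bigP D) : ℝ) : ℂ)‖ = ell D ^ 9 := by
    rw [Complex.norm_real, log_bigP₀, Real.norm_of_nonneg (by positivity)]
  -- `‖c₀‖ ≤ kc/𝓛⁷`
  have hc0 : ‖deriv χ.LFunction 1 * (betaJ c' D (j + 1) * betaJ c' D (j + 2)) *
      (Real.log (bigP D) : ℂ) / 500‖ ≤ kc / ell D ^ 7 := by
    rw [norm_div, norm_mul, norm_mul, norm_mul, hΛn,
      show ‖(500 : ℂ)‖ = 500 by norm_num]
    calc ‖deriv χ.LFunction 1‖ * (‖betaJ c' D (j + 1)‖ * ‖betaJ c' D (j + 2)‖) * ell D ^ 9 / 500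
        ≤ (cL * ell D ^ 2) * ((4 * alpha D) * (4 * alpha D)) * ell D ^ 9 / 500 := by gcongr
      _ = kc / ell D ^ 7 := by rw [hkc, hαeq]; field_simp
  -- `eM ≤ kM/𝓛¹⁴`, `BM + eM ≤ kBW/𝓛⁷`
  have heM : (1.25 * C₂p + 2.3 * C₁p) * (ell D ^ 15)⁻¹ +
      2.3 * 9000 * ‖deriv χ.LFunction 1‖ * (ell D ^ 16)⁻¹ ≤ kM / ell D ^ 14 := by
    have h1 : (1.25 * C₂p + 2.3 * C₁p) * (ell D ^ 15)⁻¹ ≤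
        (1.25 * C₂p + 2.3 * C₁p) * (ell D ^ 14)⁻¹ :=
      mul_le_mul_of_nonneg_left
        (inv_anti₀ (pow_pos hℓ0 14) (pow_le_pow_right₀ hℓ1 (by norm_num))) (by positivity)
    have h2 : 2.3 * 9000 * ‖deriv χ.LFunction 1‖ * (ell D ^ 16)⁻¹ ≤
        2.3 * 9000 * cL * (ell D ^ 14)⁻¹ := by
      calc 2.3 * 9000 * ‖deriv χ.LFunction 1‖ * (ell D ^ 16)⁻¹
          ≤ 2.3 * 9000 * (cL * ell D ^ 2) * (ell D ^ 16)⁻¹ := by gcongr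
        _ = 2.3 * 9000 * cL * (ell D ^ 14)⁻¹ := by field_simp
    calc _ ≤ (1.25 * C₂p + 2.3 * C₁p) * (ell D ^ 14)⁻¹ + 2.3 * 9000 * cL * (ell D ^ 14)⁻¹ :=
          add_le_add h1 h2
      _ = kM / ell D ^ 14 := by rw [hkM]; ring
  have hBM : 207 * (4 * Real.exp (9 / 2)) * (ell D ^ 7)⁻¹ ≤ kBW / ell D ^ 7 := by
    rw [hkBW, ← hcL]
    calc 207 * cL * (ell D ^ 7)⁻¹ ≤ 207 * cL * (ell D ^ 7)⁻¹ + kM * (ell D ^ 7)⁻¹ :=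
          le_add_of_nonneg_right (by positivity)
      _ = (207 * cL + kM) / ell D ^ 7 := by ring
  have hB : 207 * (4 * Real.exp (9 / 2)) * (ell D ^ 7)⁻¹ +
      ((1.25 * C₂p + 2.3 * C₁p) * (ell D ^ 15)⁻¹ +
        2.3 * 9000 * ‖deriv χ.LFunction 1‖ * (ell D ^ 16)⁻¹) ≤ kBW / ell D ^ 7 := by
    have h14 : kM / ell D ^ 14 ≤ kM / ell D ^ 7 :=
      div_le_div_of_nonneg_left hkM0 (pow_pos hℓ0 7) (pow_le_pow_right₀ hℓ1 (by norm_num))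
    rw [hkBW, ← hcL]
    calc 207 * cL * (ell D ^ 7)⁻¹ + ((1.25 * C₂p + 2.3 * C₁p) * (ell D ^ 15)⁻¹ +
          2.3 * 9000 * ‖deriv χ.LFunction 1‖ * (ell D ^ 16)⁻¹)
        ≤ 207 * cL * (ell D ^ 7)⁻¹ + kM / ell D ^ 7 := add_le_add le_rfl (heM.trans h14)
      _ = (207 * cL + kM) / ell D ^ 7 := by ring
  -- `(3 + t)·eW ≤ kW/𝓛³`
  have hW : (3 + t) * (2000 * (110 * (4 * Real.exp (9 / 2)) * ell D ^ 2 + CAp +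
      C₃p * t * (1 + t) ^ 3) / ell D ^ 9) ≤ kW / ell D ^ 3 := by
    rw [← hcL]
    have hwf := window_factor_le (cL := cL) (CA := CAp) (C₃ := C₃p) hℓ1 ht1 ht2 ht5 hcL0
      (le_max_right _ _) (le_max_right _ _)
    calc (3 + t) * (2000 * (110 * cL * ell D ^ 2 + CAp + C₃p * t * (1 + t) ^ 3) / ell D ^ 9)
        = 2000 * ((3 + t) * (110 * cL * ell D ^ 2 + CAp + C₃p * t * (1 + t) ^ 3)) / ell D ^ 9 := by
          ring
      _ ≤ 2000 * ((440 * cL + 4 * CAp + 32 * C₃p) * ell D ^ 6) / ell D ^ 9 := by gcongr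
      _ = kW / ell D ^ 3 := by rw [hkW]; field_simp
  -- conclude
  have hfin := final_arith (e := Real.exp 256) (t := t) hℓ1 hε (Real.exp_pos _).le
    (by positivity) ht2 (by positivity) (by positivity) (by positivity) (norm_nonneg _)
    (by positivity) (by positivity) hkBW0 hkM0 (le_max_right CN 0) hkc0 hkW0
    hWm hWw hB heM (div_eq_mul_inv CNp (ell D ^ 15)).symm.le hc0 hW hBM
    (by rw [hK] at hℓbig; exact hℓbig)
  rw [hαeq]
  exact hfin

end Final


end Low1214

/-- **`Z22:§10.u055 (i)` holds** for `c′ ≥ 0` — the leaf-side name (namespace `Typed.Sec10C`) of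
`Low1214.low1214Eval_holds`. [cite: Zhang2022LandauSiegel, §10 p. 60] -/
theorem low1214Eval_holds {c' : ℝ} (hc' : 0 ≤ c') : Low1214Eval c' := Low1214.low1214Eval_holds hc'

end Literature.NumberTheory.LFunctions.Zhang2022.Typed.Sec10C
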